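import Literature.Analysis.FluidPDE.TorusWordAgmonWavenumber
import Literature.Analysis.FluidPDE.TorusVorticityTensorTransport
import Literature.Analysis.FunctionSpaces.TorusSobolevL6

/-!
# Berselli 2023 on `T³`: the stretching identity `∫(ω·∇)u·ω = ∫ ε_{ijk} uᵢ (ω × ∂ⱼω)ₖ` and
# Lemmas 3.1–3.2 (the vorticity direction at the six grid points `x ± λeⱼ`)

Analysis/FluidPDE proof file (theorems only; no definitions, no named facts).

search for candidate a priori estimates; no regularity claim (cell `pub-nsfunc`, literature seat:
this file types three PRINTED tools of [Berselli2023] — an identity and two lemmas — on the torus;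
it does NOT state the paper's Theorem 1.1 and claims nothing new).

Source: L. C. Berselli, *On the vorticity direction and the regularity of 3D Navier–Stokes
equations*, Nonlinearity 36 (2023) 4303–4313, §3 (space-periodic case `x ∈ 𝕋³`; `ω = curl u`,
`ω̂ = ω/|ω|`, Einstein summation, `eⱼ` the coordinate unit vectors, `λ > 0`, `C̄₁ > 0`; the
paper's hypothesis (4) is `sin∠(ω̂(x,t), ω̂(y,t)) ≤ C̄₁` at the six grid points `y = x ± λeⱼ`,
i.e. `|ω(x) × ω(x ± λeⱼ)| ≤ C̄₁ |ω(x)| |ω(x ± λeⱼ)|`, the form in which the proofs use it).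
Printed (p. 4306–4307):

"The starting point is the following elementary identity, obtained by integrating by parts and
using that `ω` is divergence-free `∫(ω·∇)u·ω dx = −∫(ω·∇)ω·u dx = … = ∫ uₖ(∂ⱼωⱼ ωₖ − ωⱼ∂ⱼωₖ) dx`,
which can be also written in the following way (as the reader can check by a direct computation)
`∫(ω·∇)u·ω dx = ∫ ε_{ijk} uᵢ (ω × ∂ⱼω)ₖ dx`, where `ε_{ijk}` is the totally anti-symmetric tensor
such that `(a × b)ᵢ = ε_{ijk} aⱼ bₖ`. This shows that `|∫(ω·∇)u·ω dx| ≤ ∫ |u| |ω × ∇ω| dx`."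

"**Lemma 3.1.** Let `ω` be `C²` function and let `j = 1, 2, 3`. Then, if (4) holds true and given
`h ∈ ℝ` such that `|h| = λ`, the following inequality holds true
`|ω(x) × ∂ⱼω(x)| ≤ (C̄₁/λ) |ω(x)| |ω(x + heⱼ)| + (λ/2) |ω(x)| |∂²ⱼⱼω(x + ξeⱼ)|`,
for some `ξ ∈ ℝ`, such that `0 < |ξ| < λ`." (Proof: Taylor's formula of order one with Lagrange
remainder along `eⱼ`, the exterior product with `ω(x)`, `ω(x) × ω(x) = 0`, and (4).)

"**Lemma 3.2.** Let `u ∈ H⁵(Ω)` and let condition (4) be satisfied, then the following inequality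
holds true `|∫(ω·∇)u·ω dx| ≤ c₁ (C̄₁/λ) ‖u‖₂ ‖ω‖₂^{1/2} ‖∇ω‖₂^{3/2} + c₂ (λ/2) ‖u‖₂ ‖ω‖₂ ‖u‖_{H⁵}`,
where `c₁` and `c₂` are non-negative constants independent on `u` and `ν`." (Proof: the identity,
Lemma 3.1, Hölder, "invariance of the Lebesgue measure by translation", Ladyzhenskaya's
`‖f‖₄ ≤ c‖f‖₂^{1/4}‖∇f‖₂^{3/4}` and the Morrey embedding `‖u‖_{W^{3,∞}} ≤ c₂‖u‖_{H⁵}`.)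

What is typed (unit torus `T^d`, `card d = 3` read through a frame `e : d ≃ Fin 3`; vectors in
the frame: `k⁺ = e⁻¹(e k + 1)`, `k⁺⁺ = e⁻¹(e k + 2)`, `(a × b)ₖ = a_{k⁺} b_{k⁺⁺} − a_{k⁺⁺} b_{k⁺}`,
`|a × b| = (∑ₖ (a × b)ₖ²)^{1/2}`, the Levi-Civita symbol `ε_{ijk} = 1` if `(e j, e k) =
(e i + 1, e i + 2)`, `−1` if `(e j, e k) = (e i + 2, e i + 1)`, `0` otherwise — supplied through a
defining hypothesis `hε`, no definition is introduced):
* `Torus.integral_vorticityStretching_eq_integral_leviCivita_cross` — the identity, for smooth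
  `u` and ANY smooth divergence-free `ω : T^d → ℝ^d` (the printed `ω = curl u` is divergence-free;
  only `div ω = 0` is used, as printed), and its printed consequence
  `Torus.abs_integral_vorticityStretching_le_integral_norm_mul_cross`
  (`|∫(ω·∇)u·ω| ≤ ∫ |u| ∑ⱼ |ω × ∂ⱼω|`, `|ω × ∇ω|` read as `∑ⱼ |ω × ∂ⱼω|`, the form used in the
  proof of Lemma 3.2);
* `Torus.sqrt_sum_cross_partialDeriv_sq_le_of_sixPoint` — Lemma 3.1, for a `C²` field `ω`, in
  COMPONENTWISE form (see Deviations);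
* `Torus.abs_integral_vorticityStretching_le_of_sixPoint` — Lemma 3.2 for smooth mean-zero `u` on
  `T^d` with `ω` its vorticity read in the frame (`ωₖ = W_{k⁺k⁺⁺}(u)`, `W` the tree's
  `torusVorticityTensor`), `‖u‖_{H⁵} = (sobolevEnergy 5 u)^{1/2}` (the tree's squared `H⁵` norm
  with all ordered derivative words), `‖∇ω‖₂² = ∫ ∑ⱼ ‖∂ⱼω‖²`; the constants `c₁, c₂ ≥ 0` are
  existential, quantified BEFORE `u, λ, C̄₁, h` (they depend on `d` only).

Deviations, declared: (1) Lemma 3.1 is typed in componentwise form; constant absorbs `√3`: the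
printed vector Taylor formula with ONE intermediate point `ξ` is applied to each component `ωₖ`
(Lagrange's remainder exists for real-valued functions), giving points `ξₖ`, `0 < |ξₖ| < λ`, and
the remainder `(∑ₖ (∂²ⱼⱼωₖ(x + ξₖeⱼ))²)^{1/2}` in place of `|∂²ⱼⱼω(x + ξeⱼ)|`; against a uniform
bound `M` of the second derivatives this costs the factor `√3`, absorbed in `c₂` of Lemma 3.2,
whose printed statement is typed as printed. (2) Hypothesis (4) enters Lemma 3.1 only at the pair
`(x, x + heⱼ)` and Lemma 3.2 only at the pairs `(x, x + heⱼ)`, all `x`, `j`, for the given `h`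
with `|h| = λ` — weaker hypotheses than the printed six-point condition, which contains them.
(3) Unit torus (side `1`) instead of side `2π`; Leray–Hopf/`H⁵` generality replaced by smooth
fields (the case the paper's proof treats, p. 4307: strong solutions are smooth for `t > 0`).
(4) No statement about solutions of the Navier–Stokes equations is made in this file.

## Mathlib / tree search

Tree (used): `Torus.partialDeriv`/`Torus.lineDeriv`, `hasDerivAt_comp_add_proj_smul`,
`partialDeriv_apply_coord`, `partialDeriv_comm`, `partialDeriv_mul`, `partialDeriv_sub`,
`integral_partialDeriv_eq_zero_holds` (integration by parts on `T^d`), `torusVorticityTensor`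
(`TorusVorticityTensorTransport`), `hasZeroMean_partialDeriv`, Ladyzhenskaya on `T³`
`Torus.integral_norm_pow_four_le_of_hasZeroMean` (`TorusSobolevL6`),
`norm_fderiv_sq_le_card_mul_sum`,
Agmon at every rung `Torus.sum_norm_sq_wordDeriv_le_agmon_wordEnergy` with `wordEnergy`,
`sobolevEnergy` (`TorusWordAgmonWavenumber`, `TorusWordEnergy`), `integral_mul_le_sqrt_mul_sqrt'`;
Mathlib `taylor_mean_remainder_lagrange_iteratedDeriv`, `integral_add_right_eq_self` (translation
invariance of Haar measure on `T^d`), `contDiff_euclidean`. Searched (`lean search --decl`):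
`sixPoint|six_point|Berselli2023|leviCivita.*cross|cross_partialDeriv` — nothing in the tree
(`TorusNSBerselliCordobaCriterion`, `TorusNSBerselliGaldiCriterion` are other results).

## References

* [Berselli2023] L. C. Berselli, *On the vorticity direction and the regularity of 3D
  Navier–Stokes equations*, Nonlinearity 36 (2023) no. 8, 4303–4313,
  doi:10.1088/1361-6544/ace096 — §3: the identity (p. 4306–4307, the unnumbered displays after
  the citation of [2, Lemma 4.1]), Lemma 3.1 (p. 4307), Lemma 3.2 (p. 4307–4308). Held text
  `paper:url-661547ea7229`.
* [MajdaBertozziCUP2002] A. J. Majda, A. L. Bertozzi, *Vorticity and Incompressible Flow*, CUP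
  2002, §1.4 (1.19)–(1.21) (the vorticity tensor and `ω = curl v`, via the tree).
-/

noncomputable section

open Set MeasureTheory Filter Real

namespace Literature.Analysis.FluidPDE

open Literature.Analysis.FunctionSpaces Literature.Analysis.FunctionSpaces.Torus

variable {d : Type*} [Fintype d] [DecidableEq d]

/-! ### §1 Frame algebra: sums through `e : d ≃ Fin 3`, `|a × b| ≤ |a||b|`, the `ε`-contraction -/

namespace Berselli2023

omit [DecidableEq d] in
/-- Sums over `d` read through a frame `e : d ≃ Fin 3`. (Proof device.) [folklore] -/
private theorem sum_eq_sum_fin3 (e : d ≃ Fin 3) (G : d → ℝ) :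
    ∑ i, G i = ∑ a : Fin 3, G (e.symm a) :=
  Fintype.sum_equiv e _ _ fun i => by simp

omit [Fintype d] [DecidableEq d] in
/-- Addition table of `Fin 3`. (Proof device.) [folklore] -/
private theorem fin3_add :
    (0 : Fin 3) + 1 = 1 ∧ (0 : Fin 3) + 2 = 2 ∧ (1 : Fin 3) + 1 = 2 ∧ (1 : Fin 3) + 2 = 0 ∧
      (2 : Fin 3) + 1 = 0 ∧ (2 : Fin 3) + 2 = 1 := by
  decide

omit [DecidableEq d] in
/-- `‖a‖ = (∑ₖ aₖ²)^{1/2}` on `ℝ^d`. (Proof device.) [folklore] -/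
private theorem norm_eq_sqrt_sum_sq (a : EuclideanSpace ℝ d) :
    ‖a‖ = Real.sqrt (∑ k, a k ^ 2) := by
  rw [EuclideanSpace.norm_eq]
  simp [Real.norm_eq_abs, sq_abs]

omit [DecidableEq d] in
/-- `‖toLp f‖ = (∑ₖ fₖ²)^{1/2}`. (Proof device.) [folklore] -/
private theorem norm_toLp_eq_sqrt (f : d → ℝ) :
    ‖(WithLp.toLp 2 f : EuclideanSpace ℝ d)‖ = Real.sqrt (∑ k, f k ^ 2) := by
  rw [EuclideanSpace.norm_eq]
  simp [Real.norm_eq_abs, sq_abs]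

omit [DecidableEq d] in
/-- `|aₖ| ≤ ‖a‖` on `ℝ^d`. (Proof device.) [folklore] -/
private theorem abs_apply_le_norm (a : EuclideanSpace ℝ d) (k : d) : |a k| ≤ ‖a‖ := by
  rw [norm_eq_sqrt_sum_sq]
  exact Real.abs_le_sqrt
    (Finset.single_le_sum (f := fun i => a i ^ 2) (fun i _ => sq_nonneg (a i)) (Finset.mem_univ k))

omit [DecidableEq d] in
/-- **Lagrange: `|a × b|² ≤ |a|² |b|²`** in a frame, `(a × b)ₖ = a_{k⁺}b_{k⁺⁺} − a_{k⁺⁺}b_{k⁺}`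
(`|a|²|b|² − |a × b|² = (a·b)² ≥ 0`). (Proof device.) [folklore] -/
private theorem sum_cross_sq_le (e : d ≃ Fin 3) (a b : d → ℝ) :
    ∑ k, (a (e.symm (e k + 1)) * b (e.symm (e k + 2)) -
        a (e.symm (e k + 2)) * b (e.symm (e k + 1))) ^ 2 ≤ (∑ k, a k ^ 2) * ∑ k, b k ^ 2 := by
  obtain ⟨h01, h02, h11, h12, h21, h22⟩ := fin3_add
  simp only [sum_eq_sum_fin3 e, Equiv.apply_symm_apply, Fin.sum_univ_three, h01, h02, h11, h12,
    h21, h22]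
  nlinarith [sq_nonneg (a (e.symm 0) * b (e.symm 0) + a (e.symm 1) * b (e.symm 1) +
    a (e.symm 2) * b (e.symm 2))]

omit [DecidableEq d] in
/-- **`|a × b| ≤ |a| |b|`** in a frame. (Proof device.) [folklore] -/
private theorem sqrt_sum_cross_sq_le (e : d ≃ Fin 3) (a b : EuclideanSpace ℝ d) :
    Real.sqrt (∑ k, (a (e.symm (e k + 1)) * b (e.symm (e k + 2)) -
        a (e.symm (e k + 2)) * b (e.symm (e k + 1))) ^ 2) ≤ ‖a‖ * ‖b‖ := by
  rw [norm_eq_sqrt_sum_sq a, norm_eq_sqrt_sum_sq b,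
    ← Real.sqrt_mul (Finset.sum_nonneg fun k _ => sq_nonneg (a k))]
  exact Real.sqrt_le_sqrt (sum_cross_sq_le e a b)

/-- **Cauchy–Schwarz with two indices**: `|u_a C_b − u_b C_a| ≤ ‖u‖ (∑ₖ Cₖ²)^{1/2}` for `a ≠ b`
(`(ps − qr)² + (pr + qs)² = (p² + q²)(r² + s²)`). (Proof device.) [folklore] -/
private theorem abs_sub_le_norm_mul_sqrt (u : EuclideanSpace ℝ d) (C : d → ℝ) {a b : d}
    (hab : a ≠ b) : |u a * C b - u b * C a| ≤ ‖u‖ * Real.sqrt (∑ k, C k ^ 2) := by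
  have hu2 : u a ^ 2 + u b ^ 2 ≤ ∑ k, u k ^ 2 := by
    rw [← Finset.sum_pair (f := fun k => u k ^ 2) hab]
    exact Finset.sum_le_sum_of_subset_of_nonneg (Finset.subset_univ _) fun k _ _ => sq_nonneg _
  have hC2 : C a ^ 2 + C b ^ 2 ≤ ∑ k, C k ^ 2 := by
    rw [← Finset.sum_pair (f := fun k => C k ^ 2) hab]
    exact Finset.sum_le_sum_of_subset_of_nonneg (Finset.subset_univ _) fun k _ _ => sq_nonneg _
  have hua : 0 ≤ u a ^ 2 + u b ^ 2 := by positivity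
  have hkey : (u a * C b - u b * C a) ^ 2 ≤ (∑ k, u k ^ 2) * ∑ k, C k ^ 2 :=
    calc (u a * C b - u b * C a) ^ 2 ≤ (u a ^ 2 + u b ^ 2) * (C a ^ 2 + C b ^ 2) := by
          nlinarith [sq_nonneg (u a * C a + u b * C b)]
      _ ≤ (∑ k, u k ^ 2) * ∑ k, C k ^ 2 :=
          mul_le_mul hu2 hC2 (by positivity) (Finset.sum_nonneg fun k _ => sq_nonneg _)
  rw [norm_eq_sqrt_sum_sq, ← Real.sqrt_mul (Finset.sum_nonneg fun k _ => sq_nonneg (u k))]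
  exact Real.abs_le_sqrt hkey

omit [DecidableEq d] in
/-- **The `ε`-contraction over `i, k` at fixed `j` is a cross-product component**:
`∑ᵢₖ ε_{ijk} uᵢ Cₖ = u_{j⁺⁺} C_{j⁺} − u_{j⁺} C_{j⁺⁺}` (`= (C × u)ⱼ`). (Proof device.) [folklore] -/
private theorem sum_sum_eps_mul_eq (e : d ≃ Fin 3) {ε : d → d → d → ℝ}
    (hε : ∀ i j k, ε i j k = if e j = e i + 1 ∧ e k = e i + 2 then 1
      else if e j = e i + 2 ∧ e k = e i + 1 then -1 else 0)
    (u C : d → ℝ) (j : d) :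
    ∑ i, ∑ k, ε i j k * u i * C k =
      u (e.symm (e j + 2)) * C (e.symm (e j + 1)) -
        u (e.symm (e j + 1)) * C (e.symm (e j + 2)) := by
  obtain ⟨h01, h02, h11, h12, h21, h22⟩ := fin3_add
  obtain ⟨j', hj'⟩ : ∃ j' : Fin 3, e j = j' := ⟨e j, rfl⟩
  simp only [sum_eq_sum_fin3 e, hε, Equiv.apply_symm_apply, hj', Fin.sum_univ_three, h01, h02, h11,
    h12, h21, h22]
  fin_cases j' <;> simp [h01, h02, h11, h12, h21, h22] <;> ring

/-- **`|ε_{ijk} uᵢ (a × B_j)ₖ| ≤ |u| ∑ⱼ |a × B_j|`** (for each `j` the contraction over `i, k` is a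
component of `(a × B_j) × u`, bounded by `|u| |a × B_j|`). (Proof device.) [folklore] -/
private theorem abs_sum_eps_mul_cross_le (e : d ≃ Fin 3) {ε : d → d → d → ℝ}
    (hε : ∀ i j k, ε i j k = if e j = e i + 1 ∧ e k = e i + 2 then 1
      else if e j = e i + 2 ∧ e k = e i + 1 then -1 else 0)
    (u : EuclideanSpace ℝ d) (a : d → ℝ) (B : d → d → ℝ) :
    |∑ i, ∑ j, ∑ k, ε i j k * u i * (a (e.symm (e k + 1)) * B j (e.symm (e k + 2)) -
        a (e.symm (e k + 2)) * B j (e.symm (e k + 1)))| ≤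
      ‖u‖ * ∑ j, Real.sqrt (∑ k, (a (e.symm (e k + 1)) * B j (e.symm (e k + 2)) -
        a (e.symm (e k + 2)) * B j (e.symm (e k + 1))) ^ 2) := by
  rw [Finset.sum_comm, Finset.mul_sum]
  refine (Finset.abs_sum_le_sum_abs _ _).trans (Finset.sum_le_sum fun j _ => ?_)
  have hne : e.symm (e j + 2) ≠ e.symm (e j + 1) := by
    rw [Ne, e.symm.injective.eq_iff, add_right_inj]; decide
  rw [sum_sum_eps_mul_eq e hε]
  exact abs_sub_le_norm_mul_sqrt u (fun k => a (e.symm (e k + 1)) * B j (e.symm (e k + 2)) -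
    a (e.symm (e k + 2)) * B j (e.symm (e k + 1))) hne

omit [DecidableEq d] in
/-- **`ε_{ijk} uᵢ (a × B_j)ₖ = (u·a)(∑ⱼ (B_j)ⱼ) − ∑ⱼₖ uₖ aⱼ (B_j)ₖ`** ("as the reader can check by a
direct computation": `ε_{ijk}ε_{kpq} = δ_{ip}δ_{jq} − δ_{iq}δ_{jp}`). (Proof device.) [folklore] -/
private theorem sum_eps_mul_cross_eq (e : d ≃ Fin 3) {ε : d → d → d → ℝ}
    (hε : ∀ i j k, ε i j k = if e j = e i + 1 ∧ e k = e i + 2 then 1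
      else if e j = e i + 2 ∧ e k = e i + 1 then -1 else 0)
    (u a : d → ℝ) (B : d → d → ℝ) :
    ∑ i, ∑ j, ∑ k, ε i j k * u i * (a (e.symm (e k + 1)) * B j (e.symm (e k + 2)) -
        a (e.symm (e k + 2)) * B j (e.symm (e k + 1))) =
      (∑ i, u i * a i) * (∑ j, B j j) - ∑ j, ∑ k, u k * a j * B j k := by
  obtain ⟨h01, h02, h11, h12, h21, h22⟩ := fin3_add
  simp only [sum_eq_sum_fin3 e, hε, Equiv.apply_symm_apply, Fin.sum_univ_three, h01, h02, h11, h12,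
    h21, h22]
  simp
  ring

/-! ### §2 Line calculus on the torus and Taylor's formula of order one with Lagrange remainder -/

/-- A `C²` function on the torus has `C¹` partial derivatives. (Proof device.) [folklore] -/
private theorem isContDiff_one_partialDeriv {F : Type*} [NormedAddCommGroup F] [NormedSpace ℝ F]
    {f : UnitAddTorus d → F} (hf : IsContDiff 2 f) (j : d) :
    IsContDiff 1 (Torus.partialDeriv j f) := by
  have h1 : IsContDiff 1 f := hf.of_le one_le_two
  have e1 : Torus.partialDeriv j f = fun x => Torus.lineDeriv f x (EuclideanSpace.single j 1) := rfl
  unfold IsContDiff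
  rw [e1, lift_lineDeriv h1]
  exact (ContDiff.fderiv_right (m := 1) hf (le_of_eq one_add_one_eq_two)).clm_apply contDiff_const

omit [Fintype d] [DecidableEq d] in
/-- **Taylor's formula of order one with Lagrange remainder** for a `C²` function `g : ℝ → ℝ`:
`g(h) = g(0) + h g'(0) + ½ h² g''(ξ)` for some `ξ` strictly between `0` and `h ≠ 0` (Mathlib's
`taylor_mean_remainder_lagrange_iteratedDeriv`). (Proof device.) [folklore] -/
private theorem exists_taylor_order_one {g : ℝ → ℝ} (hg : ContDiff ℝ 2 g) {h : ℝ} (hh : h ≠ 0) :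
    ∃ ξ : ℝ, 0 < |ξ| ∧ |ξ| < |h| ∧
      g h = g 0 + h * deriv g 0 + h ^ 2 / 2 * deriv (deriv g) ξ := by
  obtain ⟨ξ, hξ, hT⟩ := taylor_mean_remainder_lagrange_iteratedDeriv (f := g) (n := 1)
    (x₀ := 0) (x := h) hh.symm (hg.contDiffOn.of_le (le_of_eq (by norm_num)))
  have hU : UniqueDiffOn ℝ (uIcc (0 : ℝ) h) := uniqueDiffOn_Icc (min_lt_max.2 hh.symm)
  have hdW : derivWithin g (uIcc 0 h) 0 = deriv g 0 :=
    ((hg.differentiable (by norm_num)).differentiableAt).derivWithin (hU 0 left_mem_uIcc)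
  rw [taylorWithinEval_succ, taylor_within_zero_eval, iteratedDerivWithin_one, hdW,
    iteratedDeriv_succ, iteratedDeriv_one] at hT
  have hT' : g h = g 0 + h * deriv g 0 + h ^ 2 / 2 * deriv (deriv g) ξ := by
    norm_num at hT
    linarith
  rcases lt_or_gt_of_ne hh with hneg | hpos
  · rw [uIoo_of_gt hneg] at hξ
    exact ⟨ξ, abs_pos.2 hξ.2.ne, by rw [abs_of_neg hξ.2, abs_of_neg hneg]; linarith [hξ.1], hT'⟩
  · rw [uIoo_of_lt hpos] at hξ
    exact ⟨ξ, abs_pos.2 hξ.1.ne', by rw [abs_of_pos hξ.1, abs_of_pos hpos]; exact hξ.2, hT'⟩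

/-- **Taylor along a coordinate line on the torus, one component**: for a `C²` field
`ω : T^d → ℝ^d`, `h ≠ 0` and a component `k`,
`ωₖ(x + heⱼ) = ωₖ(x) + h ∂ⱼωₖ(x) + ½h² ∂ⱼ∂ⱼωₖ(x + ξeⱼ)` for some `0 < |ξ| < |h|`.
(Proof device.) [folklore] -/
private theorem exists_taylor_component {ω : UnitAddTorus d → EuclideanSpace ℝ d}
    (hω : IsContDiff 2 ω) (j k : d) (x : UnitAddTorus d) {h : ℝ} (hh : h ≠ 0) :
    ∃ ξ : ℝ, 0 < |ξ| ∧ |ξ| < |h| ∧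
      ω (x + proj (h • EuclideanSpace.single j (1 : ℝ))) k =
        ω x k + h * Torus.partialDeriv j ω x k +
        h ^ 2 / 2 * Torus.partialDeriv j (Torus.partialDeriv j ω)
          (x + proj (ξ • EuclideanSpace.single j (1 : ℝ))) k := by
  set E : EuclideanSpace ℝ d := EuclideanSpace.single j (1 : ℝ) with hE
  have hω1 : IsContDiff 1 ω := hω.of_le one_le_two
  have hDω1 : IsContDiff 1 (Torus.partialDeriv j ω) := isContDiff_one_partialDeriv hω j
  set g : ℝ → ℝ := fun s => ω (x + proj (s • E)) k with hg
  have hg1 : ∀ s, HasDerivAt g (Torus.partialDeriv j ω (x + proj (s • E)) k) s := fun s =>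
    (EuclideanSpace.proj k : EuclideanSpace ℝ d →L[ℝ] ℝ).hasFDerivAt.comp_hasDerivAt s
      (hasDerivAt_comp_add_proj_smul hω1 x E s)
  have hg2 : ∀ s, HasDerivAt (fun s => Torus.partialDeriv j ω (x + proj (s • E)) k)
      (Torus.partialDeriv j (Torus.partialDeriv j ω) (x + proj (s • E)) k) s := fun s =>
    (EuclideanSpace.proj k : EuclideanSpace ℝ d →L[ℝ] ℝ).hasFDerivAt.comp_hasDerivAt s
      (hasDerivAt_comp_add_proj_smul hDω1 x E s)
  have hgd : deriv g = fun s => Torus.partialDeriv j ω (x + proj (s • E)) k :=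
    funext fun s => (hg1 s).deriv
  have hgdd : deriv (deriv g) = fun s =>
      Torus.partialDeriv j (Torus.partialDeriv j ω) (x + proj (s • E)) k := by
    rw [hgd]
    exact funext fun s => (hg2 s).deriv
  have hgC : ContDiff ℝ 2 g :=
    (EuclideanSpace.proj k : EuclideanSpace ℝ d →L[ℝ] ℝ).contDiff.comp
      ((hω.liftAt x).comp (contDiff_id.smul contDiff_const))
  obtain ⟨ξ, hξ0, hξh, hT⟩ := exists_taylor_order_one hgC hh
  refine ⟨ξ, hξ0, hξh, ?_⟩
  rw [hgdd, hgd] at hT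
  simpa [hg, proj_zero] using hT

end Berselli2023

/-! ### §3 Lemma 3.1: the cross product `ω × ∂ⱼω` under the grid-point condition (4) -/

/-- **Berselli's Lemma 3.1 on `T³` (componentwise form; constant absorbs `√3`).** Printed: "Let
`ω` be `C²` function and let `j = 1, 2, 3`. Then, if (4) holds true and given `h ∈ ℝ` such that
`|h| = λ`, `|ω(x) × ∂ⱼω(x)| ≤ (C̄₁/λ)|ω(x)||ω(x + heⱼ)| + (λ/2)|ω(x)||∂²ⱼⱼω(x + ξeⱼ)|` for some
`ξ ∈ ℝ`, such that `0 < |ξ| < λ`." Here: a `C²` field `ω : T^d → ℝ^d` (`card d = 3` via a frame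
`e`), `j : d`, `λ > 0`, `|h| = λ`, `y = x + heⱼ` (`eⱼ = EuclideanSpace.single j 1`, translation
through `proj`), hypothesis (4) at the pair `(x, y)` in the form the printed proof uses it,
`|ω(x) × ω(y)| ≤ C̄₁ |ω(x)| |ω(y)|`; conclusion with one intermediate point `ξₖ`, `0 < |ξₖ| < λ`,
per component: `|ω(x) × ∂ⱼω(x)| ≤ (C̄₁/λ)|ω(x)||ω(y)| + (λ/2)|ω(x)| (∑ₖ (∂ⱼ∂ⱼωₖ(x + ξₖeⱼ))²)^{1/2}`
(componentwise form; constant absorbs `√3`: the printed single-`ξ` vector Lagrange form is applied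
to each real component, `taylor_mean_remainder_lagrange_iteratedDeriv`; against a uniform bound of
`∂ⱼ∂ⱼω` the remainder costs a factor `√3`, immaterial for the printed non-numerical constants).
Proof: the printed one — `h ∂ⱼω(x) = ω(y) − ω(x) − ½h² r`, cross with `ω(x)`, `ω(x) × ω(x) = 0`,
(4), `|ω(x) × r| ≤ |ω(x)||r|`, divide by `|h| = λ`.
[cite: Berselli2023, Lemma 3.1 (p. 4307)] -/
theorem Torus.sqrt_sum_cross_partialDeriv_sq_le_of_sixPoint (e : d ≃ Fin 3)
    {ω : UnitAddTorus d → EuclideanSpace ℝ d} (hω : IsContDiff 2 ω) (j : d) {lam C₁ h : ℝ}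
    (hlam : 0 < lam) (hh : |h| = lam) (x : UnitAddTorus d) {y : UnitAddTorus d}
    (hy : y = x + proj (h • EuclideanSpace.single j (1 : ℝ)))
    (h4 : Real.sqrt (∑ k, (ω x (e.symm (e k + 1)) * ω y (e.symm (e k + 2)) -
        ω x (e.symm (e k + 2)) * ω y (e.symm (e k + 1))) ^ 2) ≤ C₁ * ‖ω x‖ * ‖ω y‖) :
    ∃ ξ : d → ℝ, (∀ k, 0 < |ξ k| ∧ |ξ k| < lam) ∧
      Real.sqrt (∑ k, (ω x (e.symm (e k + 1)) * Torus.partialDeriv j ω x (e.symm (e k + 2)) -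
          ω x (e.symm (e k + 2)) * Torus.partialDeriv j ω x (e.symm (e k + 1))) ^ 2) ≤
        C₁ / lam * ‖ω x‖ * ‖ω y‖ + lam / 2 * ‖ω x‖ *
          Real.sqrt (∑ k, (Torus.partialDeriv j (Torus.partialDeriv j ω)
            (x + proj (ξ k • EuclideanSpace.single j (1 : ℝ))) k) ^ 2) := by
  set E : EuclideanSpace ℝ d := EuclideanSpace.single j (1 : ℝ) with hE
  have hh0 : h ≠ 0 := by
    rintro rfl
    rw [abs_zero] at hh
    exact hlam.ne' hh.symm
  -- componentwise Taylor along `s ↦ x + s eⱼ`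
  have htaylor := fun k => Berselli2023.exists_taylor_component hω j k x hh0
  choose ξ hξ0 hξh hT using htaylor
  refine ⟨ξ, fun k => ⟨hξ0 k, hh ▸ hξh k⟩, ?_⟩
  -- the remainder vector `r` and the three cross products as elements of `ℝ^d`
  set r : d → ℝ := fun k => Torus.partialDeriv j (Torus.partialDeriv j ω) (x + proj (ξ k • E)) k
    with hr
  set Cd : EuclideanSpace ℝ d := WithLp.toLp 2 fun k =>
    ω x (e.symm (e k + 1)) * Torus.partialDeriv j ω x (e.symm (e k + 2)) -
      ω x (e.symm (e k + 2)) * Torus.partialDeriv j ω x (e.symm (e k + 1)) with hCd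
  set Cy : EuclideanSpace ℝ d := WithLp.toLp 2 fun k =>
    ω x (e.symm (e k + 1)) * ω y (e.symm (e k + 2)) -
      ω x (e.symm (e k + 2)) * ω y (e.symm (e k + 1)) with hCy
  set Cr : EuclideanSpace ℝ d := WithLp.toLp 2 fun k =>
    ω x (e.symm (e k + 1)) * (WithLp.toLp 2 r : EuclideanSpace ℝ d) (e.symm (e k + 2)) -
      ω x (e.symm (e k + 2)) * (WithLp.toLp 2 r : EuclideanSpace ℝ d) (e.symm (e k + 1)) with hCr
  have hT' : ∀ k, ω y k = ω x k + h * Torus.partialDeriv j ω x k + h ^ 2 / 2 * r k := by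
    intro k; rw [hy]; exact hT k
  -- `h (ω × ∂ⱼω) = ω × ω(y) − ½h² ω × r`
  have hvec : h • Cd = Cy - (h ^ 2 / 2) • Cr := by
    refine PiLp.ext fun k => ?_
    simp only [hCd, hCy, hCr, PiLp.smul_apply, PiLp.sub_apply, smul_eq_mul]
    linear_combination (-(ω x (e.symm (e k + 1)))) * hT' (e.symm (e k + 2)) +
      ω x (e.symm (e k + 2)) * hT' (e.symm (e k + 1))
  -- norms
  have hn1 : ‖Cy‖ ≤ C₁ * ‖ω x‖ * ‖ω y‖ := by rw [hCy, Berselli2023.norm_toLp_eq_sqrt]; exact h4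
  have hn2 : ‖Cr‖ ≤ ‖ω x‖ * ‖(WithLp.toLp 2 r : EuclideanSpace ℝ d)‖ := by
    rw [hCr, Berselli2023.norm_toLp_eq_sqrt]
    exact Berselli2023.sqrt_sum_cross_sq_le e (ω x) _
  have hkey : lam * ‖Cd‖ ≤ C₁ * ‖ω x‖ * ‖ω y‖ +
      lam ^ 2 / 2 * (‖ω x‖ * ‖(WithLp.toLp 2 r : EuclideanSpace ℝ d)‖) := by
    have h2 : 0 ≤ h ^ 2 / 2 := by positivity
    calc lam * ‖Cd‖ = ‖h • Cd‖ := by rw [norm_smul, Real.norm_eq_abs, hh]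
      _ = ‖Cy - (h ^ 2 / 2) • Cr‖ := by rw [hvec]
      _ ≤ ‖Cy‖ + ‖(h ^ 2 / 2) • Cr‖ := norm_sub_le _ _
      _ = ‖Cy‖ + h ^ 2 / 2 * ‖Cr‖ := by rw [norm_smul, Real.norm_eq_abs, abs_of_nonneg h2]
      _ ≤ C₁ * ‖ω x‖ * ‖ω y‖ +
            lam ^ 2 / 2 * (‖ω x‖ * ‖(WithLp.toLp 2 r : EuclideanSpace ℝ d)‖) := by
          rw [← sq_abs h, hh]
          exact add_le_add hn1 (mul_le_mul_of_nonneg_left hn2 (by positivity))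
  have hgoal : ‖Cd‖ ≤ C₁ / lam * ‖ω x‖ * ‖ω y‖ +
      lam / 2 * ‖ω x‖ * ‖(WithLp.toLp 2 r : EuclideanSpace ℝ d)‖ :=
    calc ‖Cd‖ = lam * ‖Cd‖ / lam := by field_simp
      _ ≤ (C₁ * ‖ω x‖ * ‖ω y‖ +
            lam ^ 2 / 2 * (‖ω x‖ * ‖(WithLp.toLp 2 r : EuclideanSpace ℝ d)‖)) / lam :=
          div_le_div_of_nonneg_right hkey hlam.le
      _ = C₁ / lam * ‖ω x‖ * ‖ω y‖ +
            lam / 2 * ‖ω x‖ * ‖(WithLp.toLp 2 r : EuclideanSpace ℝ d)‖ := by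
          field_simp
  rw [hCd, Berselli2023.norm_toLp_eq_sqrt, Berselli2023.norm_toLp_eq_sqrt r] at hgoal
  simpa [hr] using hgoal

/-! ### §4 The stretching identity and its printed consequence -/

namespace Berselli2023

/-- Integration by parts for one partial derivative on `T^d` (smooth real functions; no boundary
term). (Proof device.) [folklore] -/
private theorem integral_mul_partialDeriv_eq_neg {α β : UnitAddTorus d → ℝ} (hα : IsSmooth α)
    (hβ : IsSmooth β) (k : d) :
    ∫ x, α x * Torus.partialDeriv k β x = -∫ x, Torus.partialDeriv k α x * β x := by
  have hab : IsSmooth (fun y => α y * β y) := hα.mul hβ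
  have h1 : IsSmooth (fun y => α y * Torus.partialDeriv k β y) := hα.mul (hβ.partialDeriv k)
  have h2 : IsSmooth (fun y => Torus.partialDeriv k α y * β y) := (hα.partialDeriv k).mul hβ
  have h0 : ∫ x, Torus.partialDeriv k (fun y => α y * β y) x = 0 :=
    integral_partialDeriv_eq_zero_holds hab k
  simp_rw [partialDeriv_mul (hα.isContDiff (by simp)) (hβ.isContDiff (by simp))] at h0
  rw [integral_add h1.continuous.integrable_unitAddTorus h2.continuous.integrable_unitAddTorus]
    at h0
  linarith

end Berselli2023

/-- **Berselli's stretching identity on `T³`.** Printed: "`∫(ω·∇)u·ω dx = −∫(ω·∇)ω·u dx = … =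
∫ uₖ(∂ⱼωⱼ ωₖ − ωⱼ∂ⱼωₖ) dx`, which can be also written in the following way (as the reader can
check by a direct computation) `∫(ω·∇)u·ω dx = ∫ ε_{ijk} uᵢ (ω × ∂ⱼω)ₖ dx`" (integration by parts
and `div ω = 0`). Here on the unit torus `T^d`, `card d = 3` read through a frame `e`, for smooth
`u, ω : T^d → ℝ^d` with `ω` divergence free (the printed `ω = curl u` is; only `div ω = 0` is
used, as printed): `∫ ∑ⱼₖ ωⱼ (∂ⱼu)ₖ ωₖ = ∫ ∑ᵢⱼₖ ε_{ijk} uᵢ (ω × ∂ⱼω)ₖ` with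
`(a × b)ₖ = a_{k⁺}b_{k⁺⁺} − a_{k⁺⁺}b_{k⁺}`, `k⁺ = e⁻¹(e k + 1)`, `k⁺⁺ = e⁻¹(e k + 2)`, and the
Levi-Civita symbol of the frame supplied through the defining hypothesis `hε` (`ε_{ijk} = 1`,
`−1`, `0` according as `(e j, e k) = (e i + 1, e i + 2)`, `(e i + 2, e i + 1)`, otherwise).
[cite: Berselli2023, §3, the unnumbered displays after the citation of [2, Lemma 4.1]
(p. 4306–4307)] -/
theorem Torus.integral_vorticityStretching_eq_integral_leviCivita_cross (e : d ≃ Fin 3)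
    {u ω : UnitAddTorus d → EuclideanSpace ℝ d} (hu : IsSmooth u) (hω : IsSmooth ω)
    (hdiv : Torus.IsDivFree ω) {ε : d → d → d → ℝ}
    (hε : ∀ i j k, ε i j k = if e j = e i + 1 ∧ e k = e i + 2 then 1
      else if e j = e i + 2 ∧ e k = e i + 1 then -1 else 0) :
    ∫ x, ∑ j, ∑ k, ω x j * Torus.partialDeriv j u x k * ω x k =
      ∫ x, ∑ i, ∑ j, ∑ k, ε i j k * u x i *
        (ω x (e.symm (e k + 1)) * Torus.partialDeriv j ω x (e.symm (e k + 2)) -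
          ω x (e.symm (e k + 2)) * Torus.partialDeriv j ω x (e.symm (e k + 1))) := by
  have hu1 : IsContDiff 1 u := hu.isContDiff (by simp)
  have hω1 : IsContDiff 1 ω := hω.isContDiff (by simp)
  have huk : ∀ k, IsSmooth (fun x => u x k) := fun k => hu.apply k
  have hωk : ∀ k, IsSmooth (fun x => ω x k) := fun k => hω.apply k
  have hDu : ∀ j k x, Torus.partialDeriv j u x k = Torus.partialDeriv j (fun y => u y k) x :=
    fun j k x => (partialDeriv_apply_coord hu1 j x k).symm
  have hDω : ∀ j k x, Torus.partialDeriv j ω x k = Torus.partialDeriv j (fun y => ω y k) x :=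
    fun j k x => (partialDeriv_apply_coord hω1 j x k).symm
  -- `div ω = 0` in components
  have hdivx : ∀ x, ∑ j, Torus.partialDeriv j ω x j = 0 := fun x => by
    have h := hdiv x
    simp only [Torus.divergence] at h
    simpa only [hDω] using h
  -- continuity bookkeeping
  have hcω : ∀ k, Continuous fun x => ω x k := fun k => (hωk k).continuous
  have hcu : ∀ k, Continuous fun x => u x k := fun k => (huk k).continuous
  have hcDω : ∀ j k, Continuous fun x => Torus.partialDeriv j (fun y => ω y k) x :=
    fun j k => ((hωk k).partialDeriv j).continuous
  have hcDu : ∀ j k, Continuous fun x => Torus.partialDeriv j (fun y => u y k) x :=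
    fun j k => ((huk k).partialDeriv j).continuous
  -- (i) the left-hand side, integrated by parts: `∫(ω·∇)u·ω = −∫ ∑ⱼₖ uₖ ωⱼ ∂ⱼωₖ`
  have hjk : ∀ j k, ∫ x, ω x j * Torus.partialDeriv j u x k * ω x k =
      -∫ x, (ω x j * Torus.partialDeriv j (fun y => ω y k) x +
        Torus.partialDeriv j (fun y => ω y j) x * ω x k) * u x k := by
    intro j k
    have h1 : ∀ x, ω x j * Torus.partialDeriv j u x k * ω x k =
        (ω x j * ω x k) * Torus.partialDeriv j (fun y => u y k) x := by
      intro x; rw [hDu]; ring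
    have hωjk : IsSmooth (fun x => ω x j * ω x k) := (hωk j).mul (hωk k)
    simp_rw [h1]
    rw [Berselli2023.integral_mul_partialDeriv_eq_neg hωjk (huk k) j]
    congr 1
    refine integral_congr_ae (ae_of_all _ fun x => ?_)
    dsimp only
    rw [partialDeriv_mul ((hωk j).isContDiff (by simp)) ((hωk k).isContDiff (by simp))]
  have hL : ∫ x, ∑ j, ∑ k, ω x j * Torus.partialDeriv j u x k * ω x k =
      -∫ x, ∑ j, ∑ k, u x k * ω x j * Torus.partialDeriv j ω x k := by
    have hint1 : ∀ j k, Integrable (fun x => ω x j * Torus.partialDeriv j u x k * ω x k) := by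
      intro j k
      simp_rw [hDu]
      exact (((hcω j).mul (hcDu j k)).mul (hcω k)).integrable_unitAddTorus
    have hint2 : ∀ j k, Integrable (fun x => (ω x j * Torus.partialDeriv j (fun y => ω y k) x +
        Torus.partialDeriv j (fun y => ω y j) x * ω x k) * u x k) := fun j k =>
      ((((hcω j).mul (hcDω j k)).add ((hcDω j j).mul (hcω k))).mul (hcu k)).integrable_unitAddTorus
    have hsum1 : ∫ x, ∑ j, ∑ k, ω x j * Torus.partialDeriv j u x k * ω x k =
        ∑ j, ∑ k, ∫ x, ω x j * Torus.partialDeriv j u x k * ω x k := by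
      rw [integral_finsetSum _ fun j _ => integrable_finsetSum _ fun k _ => hint1 j k]
      exact Finset.sum_congr rfl fun j _ => integral_finsetSum _ fun k _ => hint1 j k
    have hsum2 : ∫ x, ∑ j, ∑ k, (ω x j * Torus.partialDeriv j (fun y => ω y k) x +
        Torus.partialDeriv j (fun y => ω y j) x * ω x k) * u x k =
        ∑ j, ∑ k, ∫ x, (ω x j * Torus.partialDeriv j (fun y => ω y k) x +
          Torus.partialDeriv j (fun y => ω y j) x * ω x k) * u x k := by
      rw [integral_finsetSum _ fun j _ => integrable_finsetSum _ fun k _ => hint2 j k]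
      exact Finset.sum_congr rfl fun j _ => integral_finsetSum _ fun k _ => hint2 j k
    rw [hsum1]
    simp_rw [hjk]
    simp only [Finset.sum_neg_distrib]
    rw [← hsum2]
    congr 1
    refine integral_congr_ae (ae_of_all _ fun x => ?_)
    have hsplit : ∑ j, ∑ k, (ω x j * Torus.partialDeriv j (fun y => ω y k) x +
        Torus.partialDeriv j (fun y => ω y j) x * ω x k) * u x k =
        ∑ j, ∑ k, u x k * ω x j * Torus.partialDeriv j ω x k +
          (∑ j, Torus.partialDeriv j ω x j) * ∑ k, ω x k * u x k := by
      simp_rw [← hDω]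
      rw [Finset.sum_mul_sum, ← Finset.sum_add_distrib]
      refine Finset.sum_congr rfl fun j _ => ?_
      rw [← Finset.sum_add_distrib]
      refine Finset.sum_congr rfl fun k _ => ?_
      ring
    simp only [hsplit, hdivx x, zero_mul, add_zero]
  -- (ii) the right-hand side, pointwise: `ε_{ijk} uᵢ (ω × ∂ⱼω)ₖ = (u·ω) div ω − ∑ⱼₖ uₖ ωⱼ ∂ⱼωₖ`
  have hR : ∀ x, ∑ i, ∑ j, ∑ k, ε i j k * u x i *
      (ω x (e.symm (e k + 1)) * Torus.partialDeriv j ω x (e.symm (e k + 2)) -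
        ω x (e.symm (e k + 2)) * Torus.partialDeriv j ω x (e.symm (e k + 1))) =
      -∑ j, ∑ k, u x k * ω x j * Torus.partialDeriv j ω x k := by
    intro x
    rw [Berselli2023.sum_eps_mul_cross_eq e hε (u x) (ω x)
      (fun j k => Torus.partialDeriv j ω x k), hdivx x]
    ring
  rw [hL]
  simp_rw [hR]
  rw [integral_neg]

/-- **The printed consequence of the identity**: "This shows that
`|∫(ω·∇)u·ω dx| ≤ ∫ |u| |ω × ∇ω| dx`" — here with `|ω × ∇ω|` read as `∑ⱼ |ω × ∂ⱼω|` (the form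
used in the proof of Lemma 3.2; pointwise `|ε_{ijk} uᵢ (ω × ∂ⱼω)ₖ| ≤ |u| ∑ⱼ |ω × ∂ⱼω|`), for
smooth `u` and smooth divergence-free `ω` on `T^d`, `card d = 3` read through a frame `e`.
[cite: Berselli2023, §3, display after the stretching identity (p. 4307)] -/
theorem Torus.abs_integral_vorticityStretching_le_integral_norm_mul_cross (e : d ≃ Fin 3)
    {u ω : UnitAddTorus d → EuclideanSpace ℝ d} (hu : IsSmooth u) (hω : IsSmooth ω)
    (hdiv : Torus.IsDivFree ω) :
    |∫ x, ∑ j, ∑ k, ω x j * Torus.partialDeriv j u x k * ω x k| ≤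
      ∫ x, ‖u x‖ * ∑ j, Real.sqrt (∑ k,
        (ω x (e.symm (e k + 1)) * Torus.partialDeriv j ω x (e.symm (e k + 2)) -
          ω x (e.symm (e k + 2)) * Torus.partialDeriv j ω x (e.symm (e k + 1))) ^ 2) := by
  set ε : d → d → d → ℝ := fun i j k => if e j = e i + 1 ∧ e k = e i + 2 then 1
      else if e j = e i + 2 ∧ e k = e i + 1 then -1 else 0 with hεdef
  have hε : ∀ i j k, ε i j k = if e j = e i + 1 ∧ e k = e i + 2 then 1
      else if e j = e i + 2 ∧ e k = e i + 1 then -1 else 0 := fun i j k => rfl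
  rw [Torus.integral_vorticityStretching_eq_integral_leviCivita_cross e hu hω hdiv hε]
  refine (abs_integral_le_integral_abs).trans (integral_mono_of_nonneg
    (ae_of_all _ fun x => abs_nonneg _) ?_ (ae_of_all _ fun x =>
      Berselli2023.abs_sum_eps_mul_cross_le e hε (u x) (ω x)
        (fun j k => Torus.partialDeriv j ω x k)))
  -- integrability of the continuous majorant
  have hc : Continuous fun x => ‖u x‖ * ∑ j, Real.sqrt (∑ k,
      (ω x (e.symm (e k + 1)) * Torus.partialDeriv j ω x (e.symm (e k + 2)) -
        ω x (e.symm (e k + 2)) * Torus.partialDeriv j ω x (e.symm (e k + 1))) ^ 2) := by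
    have hcω : ∀ k, Continuous fun x => ω x k := fun k => (hω.apply k).continuous
    have hcD : ∀ j k, Continuous fun x => Torus.partialDeriv j ω x k := fun j k =>
      ((hω.partialDeriv j).apply k).continuous
    refine hu.continuous.norm.mul (continuous_finsetSum _ fun j _ => ?_)
    refine (continuous_finsetSum _ fun k _ => ?_).sqrt
    exact (((hcω (e.symm (e k + 1))).mul (hcD j (e.symm (e k + 2)))).sub
      ((hcω (e.symm (e k + 2))).mul (hcD j (e.symm (e k + 1))))).pow 2
  exact hc.integrable_unitAddTorus

/-! ### §5 Lemma 3.2: the stretching term under the grid-point condition (4) -/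

namespace Berselli2023

/-- The vorticity read in a frame, `ωₖ = W_{k⁺k⁺⁺}(u)`, is smooth for smooth `u`.
(Proof device.) [folklore] -/
private theorem isSmooth_vorticityField (e : d ≃ Fin 3) {u ω : UnitAddTorus d → EuclideanSpace ℝ d}
    (hu : IsSmooth u)
    (hω : ∀ x k, ω x k = torusVorticityTensor u (e.symm (e k + 1)) (e.symm (e k + 2)) x) :
    IsSmooth ω := by
  have hW : ∀ i j, IsSmooth (torusVorticityTensor u i j) := fun i j =>
    ((hu.partialDeriv i).apply j).sub ((hu.partialDeriv j).apply i)
  unfold IsSmooth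
  rw [contDiff_euclidean]
  intro k
  have hk : (fun y => (lift ω y) k) =
      lift (torusVorticityTensor u (e.symm (e k + 1)) (e.symm (e k + 2))) := by
    funext y
    simp [lift_apply, hω]
  rw [hk]
  exact hW _ _

/-- `∫ (∂ₐu)_b = 0` on the torus. (Proof device.) [folklore] -/
private theorem integral_partialDeriv_apply_eq_zero {u : UnitAddTorus d → EuclideanSpace ℝ d}
    (hu : IsSmooth u) (a b : d) : ∫ x, Torus.partialDeriv a u x b = 0 := by
  have h0 : ∫ x, Torus.partialDeriv a u x = 0 := hasZeroMean_partialDeriv hu a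
  have h := (EuclideanSpace.proj b : EuclideanSpace ℝ d →L[ℝ] ℝ).integral_comp_comm
    (hu.partialDeriv a).continuous.integrable_unitAddTorus
  rw [h0, map_zero] at h
  simpa using h

/-- The vorticity read in a frame has zero mean. (Proof device.) [folklore] -/
private theorem hasZeroMean_vorticityField (e : d ≃ Fin 3)
    {u ω : UnitAddTorus d → EuclideanSpace ℝ d} (hu : IsSmooth u)
    (hω : ∀ x k, ω x k = torusVorticityTensor u (e.symm (e k + 1)) (e.symm (e k + 2)) x) :
    HasZeroMean ω := by
  have hωs := isSmooth_vorticityField e hu hω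
  unfold HasZeroMean
  refine PiLp.ext fun k => ?_
  have h := (EuclideanSpace.proj k : EuclideanSpace ℝ d →L[ℝ] ℝ).integral_comp_comm
    hωs.continuous.integrable_unitAddTorus
  have hk : (∫ x, ω x) k = ∫ x, ω x k := by simpa using h.symm
  have hint : ∀ a b, Integrable (fun x => Torus.partialDeriv a u x b) := fun a b =>
    ((hu.partialDeriv a).apply b).continuous.integrable_unitAddTorus
  rw [hk]
  simp_rw [hω, torusVorticityTensor]
  rw [integral_sub (hint _ _) (hint _ _), integral_partialDeriv_apply_eq_zero hu,
    integral_partialDeriv_apply_eq_zero hu, sub_zero]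
  rfl

/-- `∂ⱼW_{ab}(u) = (∂ⱼ∂ₐu)_b − (∂ⱼ∂_bu)ₐ` for smooth `u`. (Proof device.) [folklore] -/
private theorem partialDeriv_vorticityTensor {u : UnitAddTorus d → EuclideanSpace ℝ d}
    (hu : IsSmooth u) (a b j : d) (x : UnitAddTorus d) :
    Torus.partialDeriv j (torusVorticityTensor u a b) x =
      Torus.partialDeriv j (Torus.partialDeriv a u) x b -
        Torus.partialDeriv j (Torus.partialDeriv b u) x a := by
  have ha : IsContDiff 1 (fun y => Torus.partialDeriv a u y b) :=
    ((hu.partialDeriv a).apply b).isContDiff (by simp)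
  have hb : IsContDiff 1 (fun y => Torus.partialDeriv b u y a) :=
    ((hu.partialDeriv b).apply a).isContDiff (by simp)
  have hfun : torusVorticityTensor u a b =
      (fun y => Torus.partialDeriv a u y b) - fun y => Torus.partialDeriv b u y a := by
    funext y; simp [torusVorticityTensor]
  rw [hfun, partialDeriv_sub ha hb j, Pi.sub_apply,
    partialDeriv_apply_coord ((hu.partialDeriv a).isContDiff (by simp)),
    partialDeriv_apply_coord ((hu.partialDeriv b).isContDiff (by simp))]

/-- The vorticity read in a frame is divergence free (`div curl = 0`, symmetry of second
derivatives). (Proof device.) [folklore] -/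
private theorem isDivFree_vorticityField (e : d ≃ Fin 3)
    {u ω : UnitAddTorus d → EuclideanSpace ℝ d} (hu : IsSmooth u)
    (hω : ∀ x k, ω x k = torusVorticityTensor u (e.symm (e k + 1)) (e.symm (e k + 2)) x) :
    IsDivFree ω := by
  intro x
  obtain ⟨h01, h02, h11, h12, h21, h22⟩ := fin3_add
  have hsym : ∀ a b c : d, Torus.partialDeriv a (Torus.partialDeriv b u) x c =
      Torus.partialDeriv b (Torus.partialDeriv a u) x c := fun a b c => by
    rw [partialDeriv_comm hu]
  have hcomp : ∀ k, (fun y => ω y k) =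
      torusVorticityTensor u (e.symm (e k + 1)) (e.symm (e k + 2)) :=
    fun k => funext fun y => hω y k
  simp only [Torus.divergence, hcomp, partialDeriv_vorticityTensor hu]
  rw [sum_eq_sum_fin3 e]
  simp only [Equiv.apply_symm_apply, Fin.sum_univ_three, h01, h02, h11, h12, h21, h22]
  linarith [hsym (e.symm 0) (e.symm 1) (e.symm 2), hsym (e.symm 1) (e.symm 2) (e.symm 0),
    hsym (e.symm 2) (e.symm 0) (e.symm 1)]

/-- **Second derivatives of the vorticity against `‖u‖_{H⁵}`** (the step
`‖D²ω‖_∞ ≤ ‖u‖_{W^{3,∞}} ≤ c₂‖u‖_{H⁵}` of the printed proof, via the tree's Agmon inequality at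
rung `3`): `|(∂ⱼ∂ⱼω)ₖ(y)| ≤ 2 (2/π²)^{1/2} (sobolevEnergy 5 u)^{1/2}` for smooth mean-zero
`u`.
(Proof device.) [folklore] -/
private theorem abs_partialDeriv_partialDeriv_vorticityField_le (e : d ≃ Fin 3)
    {u ω : UnitAddTorus d → EuclideanSpace ℝ d} (hu : IsSmooth u) (hmean : HasZeroMean u)
    (hω : ∀ x k, ω x k = torusVorticityTensor u (e.symm (e k + 1)) (e.symm (e k + 2)) x)
    (j k : d) (y : UnitAddTorus d) :
    |Torus.partialDeriv j (Torus.partialDeriv j ω) y k| ≤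
      2 * (Real.sqrt (2 / π ^ 2) * Real.sqrt (Torus.sobolevEnergy 5 u)) := by
  have hd : Fintype.card d = 3 := by simpa using Fintype.card_congr e
  have hωs := isSmooth_vorticityField e hu hω
  set S := Real.sqrt (Torus.sobolevEnergy 5 u) with hS
  -- the component of the second derivative of `ω` in terms of third derivatives of `u`
  have hcomp : Torus.partialDeriv j (Torus.partialDeriv j ω) y k =
      Torus.partialDeriv j (Torus.partialDeriv j (Torus.partialDeriv (e.symm (e k + 1)) u)) y
          (e.symm (e k + 2)) -
        Torus.partialDeriv j (Torus.partialDeriv j (Torus.partialDeriv (e.symm (e k + 2)) u)) y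
          (e.symm (e k + 1)) := by
    rw [← partialDeriv_apply_coord ((hωs.partialDeriv j).isContDiff (by simp))]
    have e1 : (fun z => Torus.partialDeriv j ω z k) = Torus.partialDeriv j (fun z => ω z k) :=
      funext fun z => (partialDeriv_apply_coord (hωs.isContDiff (by simp)) j z k).symm
    have e2 : (fun z => ω z k) = torusVorticityTensor u (e.symm (e k + 1)) (e.symm (e k + 2)) :=
      funext fun z => hω z k
    have e3 : Torus.partialDeriv j (torusVorticityTensor u (e.symm (e k + 1)) (e.symm (e k + 2))) =
        (fun z => Torus.partialDeriv j (Torus.partialDeriv (e.symm (e k + 1)) u) z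
            (e.symm (e k + 2))) -
          fun z => Torus.partialDeriv j (Torus.partialDeriv (e.symm (e k + 2)) u) z
            (e.symm (e k + 1)) :=
      funext fun z => partialDeriv_vorticityTensor hu _ _ j z
    have ha : IsContDiff 1 (fun z =>
        Torus.partialDeriv j (Torus.partialDeriv (e.symm (e k + 1)) u) z (e.symm (e k + 2))) :=
      (((hu.partialDeriv _).partialDeriv j).apply _).isContDiff (by simp)
    have hb : IsContDiff 1 (fun z =>
        Torus.partialDeriv j (Torus.partialDeriv (e.symm (e k + 2)) u) z (e.symm (e k + 1))) :=
      (((hu.partialDeriv _).partialDeriv j).apply _).isContDiff (by simp)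
    rw [e1, e2, e3, partialDeriv_sub ha hb j, Pi.sub_apply,
      partialDeriv_apply_coord (((hu.partialDeriv _).partialDeriv j).isContDiff (by simp)),
      partialDeriv_apply_coord (((hu.partialDeriv _).partialDeriv j).isContDiff (by simp))]
  -- Agmon at rung `3`: every third derivative word is bounded by `(2/π²)^{1/2} ‖u‖_{H⁵}`
  have hAg := Torus.sum_norm_sq_wordDeriv_le_agmon_wordEnergy hd hu hmean 3 y
  have hE : ∀ n, n ≤ 5 → Real.sqrt (Torus.wordEnergy n u) ≤ S := fun n hn =>
    Real.sqrt_le_sqrt (Torus.wordEnergy_le_sobolevEnergy hn u)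
  have hword : ∀ a, ‖Torus.partialDeriv j (Torus.partialDeriv j (Torus.partialDeriv a u)) y‖ ≤
      Real.sqrt (2 / π ^ 2) * S := by
    intro a
    have h1 : ‖Torus.partialDeriv j (Torus.partialDeriv j (Torus.partialDeriv a u)) y‖ ^ 2 ≤
        ∑ α : Fin 3 → d, ‖Torus.wordDeriv (List.ofFn α) u y‖ ^ 2 := by
      have := Finset.single_le_sum
        (f := fun α : Fin 3 → d => ‖Torus.wordDeriv (List.ofFn α) u y‖ ^ 2)
        (fun _ _ => sq_nonneg _) (Finset.mem_univ ![j, j, a])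
      simpa [Torus.wordDeriv] using this
    have h2 : ‖Torus.partialDeriv j (Torus.partialDeriv j (Torus.partialDeriv a u)) y‖ ^ 2 ≤
        2 / π ^ 2 * (S * S) := by
      refine h1.trans (hAg.trans ?_)
      rw [mul_assoc]
      exact mul_le_mul_of_nonneg_left (mul_le_mul (hE 4 (by norm_num)) (hE 5 (by norm_num))
        (Real.sqrt_nonneg _) (hS ▸ Real.sqrt_nonneg _)) (by positivity)
    calc ‖Torus.partialDeriv j (Torus.partialDeriv j (Torus.partialDeriv a u)) y‖
        = Real.sqrt
            (‖Torus.partialDeriv j (Torus.partialDeriv j (Torus.partialDeriv a u)) y‖ ^ 2) :=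
          (Real.sqrt_sq (norm_nonneg _)).symm
      _ ≤ Real.sqrt (2 / π ^ 2 * (S * S)) := Real.sqrt_le_sqrt h2
      _ = Real.sqrt (2 / π ^ 2) * S := by
          rw [Real.sqrt_mul (by positivity), Real.sqrt_mul_self (hS ▸ Real.sqrt_nonneg _)]
  rw [hcomp]
  refine (abs_sub _ _).trans ?_
  have ha := (abs_apply_le_norm _ (e.symm (e k + 2))).trans (hword (e.symm (e k + 1)))
  have hb := (abs_apply_le_norm _ (e.symm (e k + 1))).trans (hword (e.symm (e k + 2)))
  linarith

omit [DecidableEq d] in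
/-- `(∑ₖ rₖ²)^{1/2} ≤ √3 M` when `|rₖ| ≤ M` and `card d = 3` (the factor `√3` of the componentwise
form). (Proof device.) [folklore] -/
private theorem sqrt_sum_sq_le_sqrt_three_mul (hd : Fintype.card d = 3) {r : d → ℝ} {M : ℝ}
    (hM : 0 ≤ M) (hr : ∀ k, |r k| ≤ M) : Real.sqrt (∑ k, r k ^ 2) ≤ Real.sqrt 3 * M := by
  have h1 : ∑ k, r k ^ 2 ≤ ∑ _k : d, M ^ 2 := Finset.sum_le_sum fun k _ => by
    rw [← sq_abs]; exact pow_le_pow_left₀ (abs_nonneg _) (hr k) 2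
  rw [Finset.sum_const, Finset.card_univ, hd, nsmul_eq_mul] at h1
  calc Real.sqrt (∑ k, r k ^ 2) ≤ Real.sqrt (3 * M ^ 2) := Real.sqrt_le_sqrt (by exact_mod_cast h1)
    _ = Real.sqrt 3 * M := by rw [Real.sqrt_mul (by norm_num), Real.sqrt_sq hM]

omit [DecidableEq d] in
/-- **Hölder and translation invariance** (the first term of the printed proof):
`∫ |u| |ω| |ω(· + a)| ≤ ‖u‖₂ ‖ω‖₄²` (Cauchy–Schwarz, `|ω|²|ω(·+a)|² ≤ ½(|ω|⁴ + |ω(·+a)|⁴)` and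
`∫ |ω(x + a)|⁴ dx = ∫ |ω|⁴`, invariance of Haar measure). (Proof device.) [folklore] -/
private theorem integral_norm_mul_norm_mul_norm_translate_le
    {u ω : UnitAddTorus d → EuclideanSpace ℝ d} (hu : Continuous u) (hω : Continuous ω)
    (a : UnitAddTorus d) :
    ∫ x, ‖u x‖ * (‖ω x‖ * ‖ω (x + a)‖) ≤
      Real.sqrt (∫ x, ‖u x‖ ^ 2) * Real.sqrt (∫ x, ‖ω x‖ ^ 4) := by
  have hωa : Continuous fun x => ω (x + a) := hω.comp (continuous_id.add continuous_const)
  have hc2 : Continuous fun x => ‖ω x‖ * ‖ω (x + a)‖ := hω.norm.mul hωa.norm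
  have hc4 : Continuous fun x => ‖ω x‖ ^ 4 := hω.norm.pow 4
  have hc4a : Continuous fun x => ‖ω (x + a)‖ ^ 4 := hωa.norm.pow 4
  have hcs : Continuous fun x => (‖ω x‖ * ‖ω (x + a)‖) ^ 2 := hc2.pow 2
  have hch : Continuous fun x => (‖ω x‖ ^ 4 + ‖ω (x + a)‖ ^ 4) / 2 := (hc4.add hc4a).div_const 2
  have h1 := Torus.integral_mul_le_sqrt_mul_sqrt' hu.norm hc2
    (fun x => norm_nonneg _) (fun x => mul_nonneg (norm_nonneg _) (norm_nonneg _))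
  have h2 : ∫ x, (‖ω x‖ * ‖ω (x + a)‖) ^ 2 ≤ ∫ x, ‖ω x‖ ^ 4 := by
    have hpt : ∀ x, (‖ω x‖ * ‖ω (x + a)‖) ^ 2 ≤ (‖ω x‖ ^ 4 + ‖ω (x + a)‖ ^ 4) / 2 := fun x => by
      nlinarith [sq_nonneg (‖ω x‖ ^ 2 - ‖ω (x + a)‖ ^ 2)]
    have htr : ∫ x, ‖ω (x + a)‖ ^ 4 = ∫ x, ‖ω x‖ ^ 4 :=
      integral_add_right_eq_self (fun x => ‖ω x‖ ^ 4) a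
    calc ∫ x, (‖ω x‖ * ‖ω (x + a)‖) ^ 2 ≤ ∫ x, (‖ω x‖ ^ 4 + ‖ω (x + a)‖ ^ 4) / 2 :=
          integral_mono hcs.integrable_unitAddTorus hch.integrable_unitAddTorus hpt
      _ = ((∫ x, ‖ω x‖ ^ 4) + ∫ x, ‖ω (x + a)‖ ^ 4) / 2 := by
          rw [integral_div, integral_add hc4.integrable_unitAddTorus hc4a.integrable_unitAddTorus]
      _ = ∫ x, ‖ω x‖ ^ 4 := by rw [htr]; ring
  exact h1.trans (mul_le_mul_of_nonneg_left (Real.sqrt_le_sqrt h2) (Real.sqrt_nonneg _))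

omit [Fintype d] [DecidableEq d] in
/-- Exponent bookkeeping: `(K L^{1/2} (3G)^{3/2})^{1/2} = K^{1/2} 3^{3/4} L^{1/4} G^{3/4}`, written
with square roots. (Proof device.) [folklore] -/
private theorem sqrt_mul_rpow_mul_rpow_eq {K L G : ℝ} (hK : 0 ≤ K) (hL : 0 ≤ L) (hG : 0 ≤ G) :
    Real.sqrt (K * L ^ (1 / 2 : ℝ) * (3 * G) ^ (3 / 2 : ℝ)) =
      Real.sqrt K * Real.sqrt 3 ^ (3 / 2 : ℝ) * Real.sqrt L ^ (1 / 2 : ℝ) *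
        Real.sqrt G ^ (3 / 2 : ℝ) := by
  have h3 : (0 : ℝ) ≤ 3 := by norm_num
  rw [Real.mul_rpow h3 hG]
  simp only [Real.sqrt_eq_rpow]
  rw [Real.mul_rpow (x := K * L ^ (1 / 2 : ℝ)) (y := (3 : ℝ) ^ (3 / 2 : ℝ) * G ^ (3 / 2 : ℝ))
      (by positivity) (by positivity),
    Real.mul_rpow (x := K) (y := L ^ (1 / 2 : ℝ)) hK (by positivity),
    Real.mul_rpow (x := (3 : ℝ) ^ (3 / 2 : ℝ)) (y := G ^ (3 / 2 : ℝ)) (by positivity)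
      (by positivity)]
  simp only [← Real.rpow_mul hL, ← Real.rpow_mul hG, ← Real.rpow_mul h3]
  ring_nf

/-- **Ladyzhenskaya on `T³` in the printed shape** `‖ω‖₄² ≤ c ‖ω‖₂^{1/2} ‖∇ω‖₂^{3/2}` for smooth
mean-zero fields (the tree's `Torus.integral_norm_pow_four_le_of_hasZeroMean`, with the operator
norm of the derivative bounded by the coordinate gradient). (Proof device.) [folklore] -/
private theorem exists_sqrt_integral_norm_pow_four_le (hd : Fintype.card d = 3) :
    ∃ K₁ : ℝ, 0 ≤ K₁ ∧ ∀ ω : UnitAddTorus d → EuclideanSpace ℝ d, IsSmooth ω → HasZeroMean ω →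
      Real.sqrt (∫ x, ‖ω x‖ ^ 4) ≤ K₁ * Real.sqrt (∫ x, ‖ω x‖ ^ 2) ^ (1 / 2 : ℝ) *
        Real.sqrt (∫ x, ∑ j, ‖Torus.partialDeriv j ω x‖ ^ 2) ^ (3 / 2 : ℝ) := by
  obtain ⟨K, hK⟩ := integral_norm_pow_four_le_of_hasZeroMean (F' := EuclideanSpace ℝ d) hd
  refine ⟨Real.sqrt K * Real.sqrt 3 ^ (3 / 2 : ℝ), by positivity, fun ω hω hmean => ?_⟩
  set L := ∫ x, ‖ω x‖ ^ 2 with hL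
  set G := ∫ x, ∑ j, ‖Torus.partialDeriv j ω x‖ ^ 2 with hG
  set D := ∫ x, ‖Torus.fderiv ω x‖ ^ 2 with hD
  have hL0 : 0 ≤ L := integral_nonneg fun x => by positivity
  have hG0 : 0 ≤ G := integral_nonneg fun x => Finset.sum_nonneg fun j _ => by positivity
  have hD0 : 0 ≤ D := integral_nonneg fun x => by positivity
  have hω1 : IsContDiff 1 ω := hω.isContDiff (by simp)
  -- `∫ ‖Dω‖² ≤ 3 ∫ ∑ⱼ ‖∂ⱼω‖²`
  have hDG : D ≤ 3 * G := by
    have hcD : Continuous fun x => ‖Torus.fderiv ω x‖ ^ 2 := hω1.continuous_fderiv.norm.pow 2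
    have hcG : Continuous fun x => ∑ j, ‖Torus.partialDeriv j ω x‖ ^ 2 :=
      continuous_finsetSum _ fun j _ => ((hω.partialDeriv j).continuous.norm.pow 2)
    rw [hD, hG, ← integral_const_mul]
    refine integral_mono hcD.integrable_unitAddTorus
      (hcG.integrable_unitAddTorus.const_mul 3) fun x => ?_
    have := norm_fderiv_sq_le_card_mul_sum hω1 x
    rw [hd] at this
    exact_mod_cast this
  have h4 : ∫ x, ‖ω x‖ ^ 4 ≤ K * L ^ (1 / 2 : ℝ) * (3 * G) ^ (3 / 2 : ℝ) :=
    (hK ω hω hmean).trans (mul_le_mul_of_nonneg_left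
      (Real.rpow_le_rpow hD0 hDG (by norm_num)) (by positivity))
  calc Real.sqrt (∫ x, ‖ω x‖ ^ 4) ≤ Real.sqrt (K * L ^ (1 / 2 : ℝ) * (3 * G) ^ (3 / 2 : ℝ)) :=
        Real.sqrt_le_sqrt h4
    _ = Real.sqrt K * Real.sqrt 3 ^ (3 / 2 : ℝ) * Real.sqrt L ^ (1 / 2 : ℝ) *
          Real.sqrt G ^ (3 / 2 : ℝ) := sqrt_mul_rpow_mul_rpow_eq K.2 hL0 hG0

end Berselli2023

/-- **Berselli's Lemma 3.2 on `T³`.** Printed: "Let `u ∈ H⁵(Ω)` and let condition (4) be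
satisfied, then the following inequality holds true
`|∫(ω·∇)u·ω dx| ≤ c₁ (C̄₁/λ) ‖u‖₂ ‖ω‖₂^{1/2} ‖∇ω‖₂^{3/2} + c₂ (λ/2) ‖u‖₂ ‖ω‖₂ ‖u‖_{H⁵}`, where `c₁`
and `c₂` are non-negative constants independent on `u` and `ν`." Here, on the unit torus `T^d`
(`card d = 3` read through a frame `e`): there are `c₁, c₂ ≥ 0` (depending on nothing but `d`)
such that for every smooth mean-zero `u : T^d → ℝ^d`, its vorticity read in the frame
`ω : T^d → ℝ^d`, `ωₖ = W_{k⁺k⁺⁺}(u)` (`W = torusVorticityTensor u`, Majda–Bertozzi (1.21)), every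
`λ > 0`, `C̄₁ ≥ 0` and `h` with `|h| = λ` such that (4) holds at the pairs `(x, x + heⱼ)` —
`|ω(x) × ω(x + heⱼ)| ≤ C̄₁ |ω(x)| |ω(x + heⱼ)|` for all `x` and `j` —
`|∫ ∑ⱼₖ ωⱼ (∂ⱼu)ₖ ωₖ| ≤ c₁ (C̄₁/λ) ‖u‖₂ ‖ω‖₂^{1/2} ‖∇ω‖₂^{3/2} + c₂ (λ/2) ‖u‖₂ ‖ω‖₂ ‖u‖_{H⁵}` with
`‖f‖₂ = (∫ ‖f‖²)^{1/2}`, `‖∇ω‖₂ = (∫ ∑ⱼ ‖∂ⱼω‖²)^{1/2}` and `‖u‖_{H⁵} = (sobolevEnergy 5 u)^{1/2}`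
(the tree's squared `H⁵` norm with all ordered derivative words, Majda (2.8)). Proof: the printed
one — the stretching identity, `|ε_{ijk} uᵢ (ω × ∂ⱼω)ₖ| ≤ |u| ∑ⱼ |ω × ∂ⱼω|`, Lemma 3.1 for each
`j` (componentwise form; constant absorbs `√3`), the remainder bounded through Agmon's inequality
at rung `3` (`‖D²ω‖_∞ ≤ 2‖D³u‖_∞ ≤ c ‖u‖_{H⁵}`, the tree's
`Torus.sum_norm_sq_wordDeriv_le_agmon_wordEnergy` in place of the printed Morrey embedding
`W^{3,∞} ⊂ H⁵`), then Cauchy–Schwarz, "invariance of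
the Lebesgue measure by translation" (`∫|ω(x + heⱼ)|⁴dx = ∫|ω|⁴`, Haar measure) and
Ladyzhenskaya's inequality `‖ω‖₄² ≤ c ‖ω‖₂^{1/2} ‖∇ω‖₂^{3/2}` (`ω` has zero mean).
[cite: Berselli2023, Lemma 3.2 (p. 4307–4308)] -/
theorem Torus.abs_integral_vorticityStretching_le_of_sixPoint (e : d ≃ Fin 3) :
    ∃ c₁ c₂ : ℝ, 0 ≤ c₁ ∧ 0 ≤ c₂ ∧
      ∀ (u : UnitAddTorus d → EuclideanSpace ℝ d), IsSmooth u → HasZeroMean u →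
      ∀ (ω : UnitAddTorus d → EuclideanSpace ℝ d),
        (∀ x k, ω x k = torusVorticityTensor u (e.symm (e k + 1)) (e.symm (e k + 2)) x) →
      ∀ (lam C₁ h : ℝ), 0 < lam → 0 ≤ C₁ → |h| = lam →
        (∀ (x : UnitAddTorus d) (j : d),
          Real.sqrt (∑ k, (ω x (e.symm (e k + 1)) *
              ω (x + proj (h • EuclideanSpace.single j (1 : ℝ))) (e.symm (e k + 2)) -
            ω x (e.symm (e k + 2)) *
              ω (x + proj (h • EuclideanSpace.single j (1 : ℝ))) (e.symm (e k + 1))) ^ 2) ≤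
            C₁ * ‖ω x‖ * ‖ω (x + proj (h • EuclideanSpace.single j (1 : ℝ)))‖) →
        |∫ x, ∑ j, ∑ k, ω x j * Torus.partialDeriv j u x k * ω x k| ≤
          c₁ * (C₁ / lam) * Real.sqrt (∫ x, ‖u x‖ ^ 2) *
              Real.sqrt (∫ x, ‖ω x‖ ^ 2) ^ (1 / 2 : ℝ) *
              Real.sqrt (∫ x, ∑ j, ‖Torus.partialDeriv j ω x‖ ^ 2) ^ (3 / 2 : ℝ) +
            c₂ * (lam / 2) * Real.sqrt (∫ x, ‖u x‖ ^ 2) * Real.sqrt (∫ x, ‖ω x‖ ^ 2) *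
              Real.sqrt (Torus.sobolevEnergy 5 u) := by
  have hd : Fintype.card d = 3 := by simpa using Fintype.card_congr e
  obtain ⟨K₁, hK₁, hLad⟩ := Berselli2023.exists_sqrt_integral_norm_pow_four_le (d := d) hd
  refine ⟨3 * K₁, 3 * (Real.sqrt 3 * (2 * Real.sqrt (2 / π ^ 2))), by positivity, by positivity,
    fun u hu hmean ω hω lam C₁ h hlam hC₁ hh h4 => ?_⟩
  -- the Levi-Civita symbol of the frame
  set ε : d → d → d → ℝ := fun i j k => if e j = e i + 1 ∧ e k = e i + 2 then 1
      else if e j = e i + 2 ∧ e k = e i + 1 then -1 else 0 with hεdef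
  have hε : ∀ i j k, ε i j k = if e j = e i + 1 ∧ e k = e i + 2 then 1
      else if e j = e i + 2 ∧ e k = e i + 1 then -1 else 0 := fun i j k => rfl
  have hωs : IsSmooth ω := Berselli2023.isSmooth_vorticityField e hu hω
  have hω2 : IsContDiff 2 ω := hωs.isContDiff (n := 2) (by decide)
  have hωmean : HasZeroMean ω := Berselli2023.hasZeroMean_vorticityField e hu hω
  have hωdiv : IsDivFree ω := Berselli2023.isDivFree_vorticityField e hu hω
  -- the uniform bound of the remainder of Lemma 3.1 (componentwise form; constant absorbs `√3`)
  obtain ⟨R, hRdef⟩ : ∃ R : ℝ, R = Real.sqrt 3 * (2 * (Real.sqrt (2 / π ^ 2) *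
      Real.sqrt (Torus.sobolevEnergy 5 u))) := ⟨_, rfl⟩
  have hR0 : 0 ≤ R := by rw [hRdef]; positivity
  have hR : ∀ (x : UnitAddTorus d) (j : d) (ξ : d → ℝ),
      Real.sqrt (∑ k, (Torus.partialDeriv j (Torus.partialDeriv j ω)
        (x + proj (ξ k • EuclideanSpace.single j (1 : ℝ))) k) ^ 2) ≤ R := fun x j ξ => by
    rw [hRdef]
    exact Berselli2023.sqrt_sum_sq_le_sqrt_three_mul hd (by positivity) fun k =>
      Berselli2023.abs_partialDeriv_partialDeriv_vorticityField_le e hu hmean hω j k _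
  -- Step 1 (pointwise): the `ε`-form bounded through Lemma 3.1 for each `j`
  have hpt : ∀ x, |∑ i, ∑ j, ∑ k, ε i j k * u x i *
      (ω x (e.symm (e k + 1)) * Torus.partialDeriv j ω x (e.symm (e k + 2)) -
        ω x (e.symm (e k + 2)) * Torus.partialDeriv j ω x (e.symm (e k + 1)))| ≤
      ∑ j, (C₁ / lam * (‖u x‖ * (‖ω x‖ *
          ‖ω (x + proj (h • EuclideanSpace.single j (1 : ℝ)))‖)) +
        lam / 2 * R * (‖u x‖ * ‖ω x‖)) := by
    intro x
    refine (Berselli2023.abs_sum_eps_mul_cross_le e hε (u x) (ω x)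
      (fun j k => Torus.partialDeriv j ω x k)).trans ?_
    rw [Finset.mul_sum]
    refine Finset.sum_le_sum fun j _ => ?_
    obtain ⟨ξ, -, hξ⟩ :=
      Torus.sqrt_sum_cross_partialDeriv_sq_le_of_sixPoint e hω2 j hlam hh x rfl (h4 x j)
    have h1 := mul_le_mul_of_nonneg_left (hR x j ξ) (by positivity : (0 : ℝ) ≤ lam / 2 * ‖ω x‖)
    calc ‖u x‖ * Real.sqrt (∑ k, (ω x (e.symm (e k + 1)) *
            Torus.partialDeriv j ω x (e.symm (e k + 2)) -
          ω x (e.symm (e k + 2)) * Torus.partialDeriv j ω x (e.symm (e k + 1))) ^ 2)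
        ≤ ‖u x‖ * (C₁ / lam * ‖ω x‖ * ‖ω (x + proj (h • EuclideanSpace.single j (1 : ℝ)))‖ +
            lam / 2 * ‖ω x‖ * R) :=
          mul_le_mul_of_nonneg_left (hξ.trans (by linarith)) (norm_nonneg _)
      _ = _ := by ring
  -- Step 2: integrate; Cauchy–Schwarz, translation invariance, Ladyzhenskaya
  have hcω : Continuous ω := hωs.continuous
  have hcu : Continuous u := hu.continuous
  have hcωj : ∀ j : d, Continuous fun x : UnitAddTorus d =>
      ω (x + proj (h • EuclideanSpace.single j (1 : ℝ))) :=
    fun j => hcω.comp (continuous_id.add continuous_const)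
  have hIj_int : ∀ j : d, Integrable (fun x => ‖u x‖ * (‖ω x‖ *
      ‖ω (x + proj (h • EuclideanSpace.single j (1 : ℝ)))‖)) :=
    fun j => (hcu.norm.mul (hcω.norm.mul (hcωj j).norm)).integrable_unitAddTorus
  have hI0_int : Integrable (fun x => ‖u x‖ * ‖ω x‖) :=
    (hcu.norm.mul hcω.norm).integrable_unitAddTorus
  have hF_int : ∀ j : d, Integrable (fun x => C₁ / lam * (‖u x‖ * (‖ω x‖ *
      ‖ω (x + proj (h • EuclideanSpace.single j (1 : ℝ)))‖)) + lam / 2 * R * (‖u x‖ * ‖ω x‖)) :=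
    fun j => ((hIj_int j).const_mul _).add (hI0_int.const_mul _)
  have hint_eq : ∫ x, ∑ j, (C₁ / lam * (‖u x‖ * (‖ω x‖ *
      ‖ω (x + proj (h • EuclideanSpace.single j (1 : ℝ)))‖)) + lam / 2 * R * (‖u x‖ * ‖ω x‖)) =
      ∑ j, (C₁ / lam * (∫ x, ‖u x‖ * (‖ω x‖ *
        ‖ω (x + proj (h • EuclideanSpace.single j (1 : ℝ)))‖)) +
        lam / 2 * R * (∫ x, ‖u x‖ * ‖ω x‖)) := by
    rw [integral_finsetSum _ fun j _ => hF_int j]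
    refine Finset.sum_congr rfl fun j _ => ?_
    rw [integral_add ((hIj_int j).const_mul _) (hI0_int.const_mul _), integral_const_mul,
      integral_const_mul]
  have hIj : ∀ j : d, ∫ x, ‖u x‖ * (‖ω x‖ *
      ‖ω (x + proj (h • EuclideanSpace.single j (1 : ℝ)))‖) ≤
      Real.sqrt (∫ x, ‖u x‖ ^ 2) * Real.sqrt (∫ x, ‖ω x‖ ^ 4) :=
    fun j => Berselli2023.integral_norm_mul_norm_mul_norm_translate_le hcu hcω _
  have hQ : Real.sqrt (∫ x, ‖ω x‖ ^ 4) ≤ K₁ * Real.sqrt (∫ x, ‖ω x‖ ^ 2) ^ (1 / 2 : ℝ) *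
      Real.sqrt (∫ x, ∑ j, ‖Torus.partialDeriv j ω x‖ ^ 2) ^ (3 / 2 : ℝ) := hLad ω hωs hωmean
  have hI0 : ∫ x, ‖u x‖ * ‖ω x‖ ≤ Real.sqrt (∫ x, ‖u x‖ ^ 2) * Real.sqrt (∫ x, ‖ω x‖ ^ 2) :=
    Torus.integral_mul_le_sqrt_mul_sqrt' hcu.norm hcω.norm (fun x => norm_nonneg _)
      fun x => norm_nonneg _
  rw [Torus.integral_vorticityStretching_eq_integral_leviCivita_cross e hu hωs hωdiv hε]
  calc |∫ x, ∑ i, ∑ j, ∑ k, ε i j k * u x i *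
          (ω x (e.symm (e k + 1)) * Torus.partialDeriv j ω x (e.symm (e k + 2)) -
            ω x (e.symm (e k + 2)) * Torus.partialDeriv j ω x (e.symm (e k + 1)))|
      ≤ ∫ x, |∑ i, ∑ j, ∑ k, ε i j k * u x i *
          (ω x (e.symm (e k + 1)) * Torus.partialDeriv j ω x (e.symm (e k + 2)) -
            ω x (e.symm (e k + 2)) * Torus.partialDeriv j ω x (e.symm (e k + 1)))| :=
        abs_integral_le_integral_abs
    _ ≤ ∫ x, ∑ j, (C₁ / lam * (‖u x‖ * (‖ω x‖ *
          ‖ω (x + proj (h • EuclideanSpace.single j (1 : ℝ)))‖)) + lam / 2 * R * (‖u x‖ * ‖ω x‖)) :=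
        integral_mono_of_nonneg (ae_of_all _ fun x => abs_nonneg _)
          (integrable_finsetSum _ fun j _ => hF_int j) (ae_of_all _ hpt)
    _ = ∑ j, (C₁ / lam * (∫ x, ‖u x‖ * (‖ω x‖ *
          ‖ω (x + proj (h • EuclideanSpace.single j (1 : ℝ)))‖)) +
          lam / 2 * R * (∫ x, ‖u x‖ * ‖ω x‖)) := hint_eq
    _ ≤ ∑ _j : d, (C₁ / lam * (Real.sqrt (∫ x, ‖u x‖ ^ 2) *
          (K₁ * Real.sqrt (∫ x, ‖ω x‖ ^ 2) ^ (1 / 2 : ℝ) *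
            Real.sqrt (∫ x, ∑ j, ‖Torus.partialDeriv j ω x‖ ^ 2) ^ (3 / 2 : ℝ))) +
          lam / 2 * R * (Real.sqrt (∫ x, ‖u x‖ ^ 2) * Real.sqrt (∫ x, ‖ω x‖ ^ 2))) :=
        Finset.sum_le_sum fun j _ => add_le_add
          (mul_le_mul_of_nonneg_left ((hIj j).trans
            (mul_le_mul_of_nonneg_left hQ (Real.sqrt_nonneg _))) (div_nonneg hC₁ hlam.le))
          (mul_le_mul_of_nonneg_left hI0 (mul_nonneg (by positivity) hR0))
    _ = 3 * K₁ * (C₁ / lam) * Real.sqrt (∫ x, ‖u x‖ ^ 2) *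
            Real.sqrt (∫ x, ‖ω x‖ ^ 2) ^ (1 / 2 : ℝ) *
            Real.sqrt (∫ x, ∑ j, ‖Torus.partialDeriv j ω x‖ ^ 2) ^ (3 / 2 : ℝ) +
          3 * (Real.sqrt 3 * (2 * Real.sqrt (2 / π ^ 2))) * (lam / 2) *
            Real.sqrt (∫ x, ‖u x‖ ^ 2) * Real.sqrt (∫ x, ‖ω x‖ ^ 2) *
            Real.sqrt (Torus.sobolevEnergy 5 u) := by
        rw [Finset.sum_const, Finset.card_univ, hd, nsmul_eq_mul, hRdef]
        push_cast
        ring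

end Literature.Analysis.FluidPDE

namespace Literature.Analysis.FluidPDE

open Literature.Analysis.FunctionSpaces Literature.Analysis.FunctionSpaces.Torus

/-! ### §6 The second line of the enstrophy display in the proof of Thm 1.1 (p. 4309), as a tool

Printed (proof of Thm 1.1, p. 4309, for a strong solution on `[t₀, T₁]`, after "we write the
vorticity equation and test by `ω`"): "`½ d/dt ‖ω‖² + ν‖∇ω‖² ≤ c₁ (C̄₁/λ) ‖u‖₂ ‖ω‖₂^{1/2}
‖∇ω‖₂^{3/2} + c₂ (λ/2) ‖u‖₂ ‖ω‖₂ ‖u‖_{H⁵} ≤ (C̄₁/λ)^{4/3} ‖∇ω‖² + c₄ ‖u₀‖₂⁴ ‖ω‖₂² + c₃ (λ/2)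
‖u‖_{H⁵} ‖∇ω‖₂², where we also used the Poincaré inequality to estimate the last term from the
right-hand side." This section types the SECOND inequality of that display as a TIME-INDEPENDENT
inequality between the two right-hand sides, applied to the stretching term through Lemma 3.2:
Young's inequality with exponents `4/3` and `4` on the first term, Poincaré's inequality
`‖u‖₂ ‖ω‖₂ ≤ c ‖∇ω‖₂²` (mean-zero divergence-free `u`, `∫|∇u|² = ∫|ω|²`) on the second.
Deviations, declared: (5) `‖u‖₂⁴` (the same-time norm) in place of the printed `‖u₀‖₂⁴` — the
form BEFORE the energy inequality `‖u(t)‖₂ ≤ ‖u₀‖₂` is invoked (no time evolution here);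
(6) `‖u‖_{H⁵} = (sobolevEnergy 5 u)^{1/2}` as in Lemma 3.2; (7) `|ω × ∇ω|` read as `∑ⱼ |ω × ∂ⱼω|`
inherited from §4–§5. HONEST SCOPE: a printed pointwise-in-time inequality, a tool; not a
criterion, not a regularity statement; no bootstrap, no Theorem 1.1, no solution of any equation
appears. -/

namespace Berselli2023

variable {d : Type*} [Fintype d] [DecidableEq d]

omit [Fintype d] [DecidableEq d] in
/-- **Young with exponents `4/3` and `4`**: `x³ b ≤ x⁴ + b⁴/4` for `x, b ≥ 0`
(`3x⁴ + b⁴ − 4x³b = (x − b)²(3x² + 2xb + b²) ≥ 0`, and `¾ ≤ 1`). (Proof device.) [folklore] -/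
private theorem pow_three_mul_le (x b : ℝ) (hx : 0 ≤ x) (hb : 0 ≤ b) :
    x ^ 3 * b ≤ x ^ 4 + b ^ 4 / 4 := by
  have h1 : 0 ≤ (x - b) ^ 2 * (3 * x ^ 2 + 2 * x * b + b ^ 2) := by positivity
  have h2 : (x - b) ^ 2 * (3 * x ^ 2 + 2 * x * b + b ^ 2) =
      3 * x ^ 4 + b ^ 4 - 4 * (x ^ 3 * b) := by
    ring
  have h3 : 0 ≤ x ^ 4 := by positivity
  linarith

omit [Fintype d] [DecidableEq d] in
/-- Exponent bookkeeping for the Young step: with `x = P^{1/3} N^{1/2}`,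
`x³ = P N^{3/2}` and `x⁴ = P^{4/3} N²` (`P, N ≥ 0`). (Proof device.) [folklore] -/
private theorem rpow_third_mul_sqrt_pow {P N : ℝ} (hP : 0 ≤ P) (hN : 0 ≤ N) :
    (P ^ (1 / 3 : ℝ) * N ^ (1 / 2 : ℝ)) ^ 3 = P * N ^ (3 / 2 : ℝ) ∧
      (P ^ (1 / 3 : ℝ) * N ^ (1 / 2 : ℝ)) ^ 4 = P ^ (4 / 3 : ℝ) * N ^ 2 := by
  constructor
  · rw [mul_pow, ← Real.rpow_natCast (P ^ (1 / 3 : ℝ)) 3, ← Real.rpow_natCast (N ^ (1 / 2 : ℝ)) 3,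
      ← Real.rpow_mul hP, ← Real.rpow_mul hN]
    norm_num
  · rw [mul_pow, ← Real.rpow_natCast (P ^ (1 / 3 : ℝ)) 4, ← Real.rpow_natCast (N ^ (1 / 2 : ℝ)) 4,
      ← Real.rpow_mul hP, ← Real.rpow_mul hN, ← Real.rpow_natCast N 2]
    norm_num

/-- **`∫ |∇u|² = ∫ |ω|²` for smooth divergence-free `u` on `T^d`** (`|ω|² = ½∑ᵢⱼ((∂ᵢu)ⱼ − (∂ⱼu)ᵢ)²`;
the cross term `∫ ∑ᵢⱼ (∂ᵢu)ⱼ (∂ⱼu)ᵢ = ∫ (div u)² = 0` by two integrations by parts).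
(Proof device.) [folklore] -/
private theorem gradNormSq_eq_integral_torusVorticitySqAt {u : UnitAddTorus d → EuclideanSpace ℝ d}
    (hu : IsSmooth u) (hdiv : IsDivFree u) :
    gradNormSq u = ∫ x, torusVorticitySqAt u x := by
  have hu1 : IsContDiff 1 u := hu.isContDiff (by simp)
  have huk : ∀ k, IsSmooth (fun x => u x k) := fun k => hu.apply k
  have hD : ∀ i j x, Torus.partialDeriv i u x j = Torus.partialDeriv i (fun y => u y j) x :=
    fun i j x => (partialDeriv_apply_coord hu1 i x j).symm
  have hcD : ∀ i j, Continuous fun x => Torus.partialDeriv i (fun y => u y j) x :=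
    fun i j => ((huk j).partialDeriv i).continuous
  -- pointwise: `|ω|² = ∑ᵢⱼ (∂ᵢu)ⱼ² − ∑ᵢⱼ (∂ᵢu)ⱼ (∂ⱼu)ᵢ`
  have hpt : ∀ x, torusVorticitySqAt u x = (∑ i, ‖Torus.partialDeriv i u x‖ ^ 2) -
      ∑ i, ∑ j, Torus.partialDeriv i (fun y => u y j) x *
        Torus.partialDeriv j (fun y => u y i) x := by
    intro x
    have hn : ∀ i, ‖Torus.partialDeriv i u x‖ ^ 2 =
        ∑ j, Torus.partialDeriv i (fun y => u y j) x ^ 2 := by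
      intro i
      rw [EuclideanSpace.norm_sq_eq]
      exact Finset.sum_congr rfl fun j _ => by rw [Real.norm_eq_abs, sq_abs, hD]
    simp only [torusVorticitySqAt, hD, hn]
    have hswap : ∑ i, ∑ j, Torus.partialDeriv j (fun y => u y i) x ^ 2 =
        ∑ i, ∑ j, Torus.partialDeriv i (fun y => u y j) x ^ 2 := Finset.sum_comm
    have hexp : ∑ i, ∑ j, (Torus.partialDeriv i (fun y => u y j) x -
        Torus.partialDeriv j (fun y => u y i) x) ^ 2 =
        ∑ i, ∑ j, Torus.partialDeriv i (fun y => u y j) x ^ 2 +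
          ∑ i, ∑ j, Torus.partialDeriv j (fun y => u y i) x ^ 2 -
          2 * ∑ i, ∑ j, Torus.partialDeriv i (fun y => u y j) x *
            Torus.partialDeriv j (fun y => u y i) x := by
      rw [Finset.mul_sum, ← Finset.sum_add_distrib, ← Finset.sum_sub_distrib]
      refine Finset.sum_congr rfl fun i _ => ?_
      rw [Finset.mul_sum, ← Finset.sum_add_distrib, ← Finset.sum_sub_distrib]
      refine Finset.sum_congr rfl fun j _ => ?_
      ring
    rw [hexp, hswap]
    ring
  -- the cross term: `∫ ∂ᵢ(uⱼ) ∂ⱼ(uᵢ) = ∫ ∂ⱼ(uⱼ) ∂ᵢ(uᵢ)` (two integrations by parts)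
  have hcross : ∀ i j, ∫ x, Torus.partialDeriv i (fun y => u y j) x *
      Torus.partialDeriv j (fun y => u y i) x =
      ∫ x, Torus.partialDeriv j (fun y => u y j) x * Torus.partialDeriv i (fun y => u y i) x := by
    intro i j
    have hβ : IsSmooth (Torus.partialDeriv j fun y => u y i) := (huk i).partialDeriv j
    have hβ' : IsSmooth (Torus.partialDeriv i fun y => u y i) := (huk i).partialDeriv i
    have h1 := integral_mul_partialDeriv_eq_neg (huk j) hβ i
    have h2 := integral_mul_partialDeriv_eq_neg (huk j) hβ' j
    have hcomm : ∀ x, Torus.partialDeriv i (Torus.partialDeriv j fun y => u y i) x =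
        Torus.partialDeriv j (Torus.partialDeriv i fun y => u y i) x :=
      fun x => partialDeriv_comm (huk i) i j x
    simp_rw [hcomm] at h1
    -- `h1 : ∫ uⱼ ∂ⱼ∂ᵢuᵢ = −∫ ∂ᵢuⱼ ∂ⱼuᵢ`, `h2 : ∫ uⱼ ∂ⱼ∂ᵢuᵢ = −∫ ∂ⱼuⱼ ∂ᵢuᵢ`
    linarith
  have hdivx : ∀ x, ∑ i, Torus.partialDeriv i (fun y => u y i) x = 0 := fun x => hdiv x
  have hint : ∀ i j, Integrable (fun x => Torus.partialDeriv i (fun y => u y j) x *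
      Torus.partialDeriv j (fun y => u y i) x) := fun i j =>
    ((hcD i j).mul (hcD j i)).integrable_unitAddTorus
  have hint2 : ∀ i j, Integrable (fun x => Torus.partialDeriv j (fun y => u y j) x *
      Torus.partialDeriv i (fun y => u y i) x) := fun i j =>
    ((hcD j j).mul (hcD i i)).integrable_unitAddTorus
  have hzero : ∫ x, ∑ i, ∑ j, Torus.partialDeriv i (fun y => u y j) x *
      Torus.partialDeriv j (fun y => u y i) x = 0 := by
    have e1 : ∫ x, ∑ i, ∑ j, Torus.partialDeriv i (fun y => u y j) x *
        Torus.partialDeriv j (fun y => u y i) x = ∑ i, ∑ j, ∫ x,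
          Torus.partialDeriv i (fun y => u y j) x * Torus.partialDeriv j (fun y => u y i) x := by
      rw [integral_finsetSum _ fun i _ => integrable_finsetSum _ fun j _ => hint i j]
      exact Finset.sum_congr rfl fun i _ => integral_finsetSum _ fun j _ => hint i j
    have e2 : ∫ x, ∑ i, ∑ j, Torus.partialDeriv j (fun y => u y j) x *
        Torus.partialDeriv i (fun y => u y i) x = ∑ i, ∑ j, ∫ x,
          Torus.partialDeriv j (fun y => u y j) x * Torus.partialDeriv i (fun y => u y i) x := by
      rw [integral_finsetSum _ fun i _ => integrable_finsetSum _ fun j _ => hint2 i j]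
      exact Finset.sum_congr rfl fun i _ => integral_finsetSum _ fun j _ => hint2 i j
    rw [e1, Finset.sum_congr rfl fun i _ => Finset.sum_congr rfl fun j _ => hcross i j, ← e2]
    have hin : ∀ x, ∑ i, ∑ j, Torus.partialDeriv j (fun y => u y j) x *
        Torus.partialDeriv i (fun y => u y i) x = 0 := fun x => by
      simp_rw [← Finset.sum_mul, hdivx x, zero_mul, Finset.sum_const_zero]
    simp_rw [hin, integral_zero]
  have hcn : Continuous fun x => ∑ i, ‖Torus.partialDeriv i u x‖ ^ 2 :=
    continuous_finsetSum _ fun i _ => (hu.partialDeriv i).continuous.norm.pow 2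
  have hcc : Continuous fun x => ∑ i, ∑ j, Torus.partialDeriv i (fun y => u y j) x *
      Torus.partialDeriv j (fun y => u y i) x :=
    continuous_finsetSum _ fun i _ => continuous_finsetSum _ fun j _ => (hcD i j).mul (hcD j i)
  simp_rw [hpt]
  rw [integral_sub hcn.integrable_unitAddTorus hcc.integrable_unitAddTorus, hzero, sub_zero,
    gradNormSq]

/-- **Poincaré twice**: `‖u‖₂ ‖ω‖₂ ≤ 27√27 ‖∇ω‖₂²` on the unit torus (`card d = 3`) for smooth
mean-zero divergence-free `u` and its vorticity `ω` read in a frame (`‖u‖₂² ≤ 27 ∫|∇u|² = 27‖ω‖₂²`,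
`‖ω‖₂² ≤ 27 ‖∇ω‖₂²`, the tree's `Torus.integral_norm_sq_le_card_pow_mul_gradNormSq`).
(Proof device.) [folklore] -/
private theorem sqrt_mul_sqrt_le_gradNormSq (e : d ≃ Fin 3)
    {u ω : UnitAddTorus d → EuclideanSpace ℝ d} (hu : IsSmooth u) (hmean : HasZeroMean u)
    (hdivu : IsDivFree u)
    (hω : ∀ x k, ω x k = torusVorticityTensor u (e.symm (e k + 1)) (e.symm (e k + 2)) x) :
    Real.sqrt (∫ x, ‖u x‖ ^ 2) * Real.sqrt (∫ x, ‖ω x‖ ^ 2) ≤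
      27 * Real.sqrt 27 * ∫ x, ∑ j, ‖Torus.partialDeriv j ω x‖ ^ 2 := by
  have hd : Fintype.card d = 3 := by simpa using Fintype.card_congr e
  have hωs : IsSmooth ω := isSmooth_vorticityField e hu hω
  have hωmean : HasZeroMean ω := hasZeroMean_vorticityField e hu hω
  -- `∫ ‖ω‖² = ∫ |ω|² = gradNormSq u`
  have hωsq : ∫ x, ‖ω x‖ ^ 2 = gradNormSq u := by
    rw [gradNormSq_eq_integral_torusVorticitySqAt hu hdivu]
    refine integral_congr_ae (ae_of_all _ fun x => ?_)
    dsimp only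
    rw [norm_eq_sqrt_sum_sq, Real.sq_sqrt (Finset.sum_nonneg fun k _ => sq_nonneg _),
      torusVorticitySqAt_eq_sum_sq_of_equiv e]
    exact Finset.sum_congr rfl fun k _ => by rw [hω]
  have hP1 : ∫ x, ‖u x‖ ^ 2 ≤ 27 * ∫ x, ‖ω x‖ ^ 2 := by
    have := integral_norm_sq_le_card_pow_mul_gradNormSq hu hmean
    rw [hd, ← hωsq] at this
    norm_num at this
    exact this
  have hP2 : ∫ x, ‖ω x‖ ^ 2 ≤ 27 * ∫ x, ∑ j, ‖Torus.partialDeriv j ω x‖ ^ 2 := by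
    have := integral_norm_sq_le_card_pow_mul_gradNormSq hωs hωmean
    rw [hd, gradNormSq] at this
    norm_num at this
    exact this
  have hL0 : 0 ≤ ∫ x, ‖ω x‖ ^ 2 := integral_nonneg fun x => by positivity
  have hG0 : 0 ≤ ∫ x, ∑ j, ‖Torus.partialDeriv j ω x‖ ^ 2 :=
    integral_nonneg fun x => Finset.sum_nonneg fun j _ => by positivity
  calc Real.sqrt (∫ x, ‖u x‖ ^ 2) * Real.sqrt (∫ x, ‖ω x‖ ^ 2)
      ≤ Real.sqrt (27 * ∫ x, ‖ω x‖ ^ 2) * Real.sqrt (∫ x, ‖ω x‖ ^ 2) :=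
        mul_le_mul_of_nonneg_right (Real.sqrt_le_sqrt hP1) (Real.sqrt_nonneg _)
    _ = Real.sqrt 27 * ∫ x, ‖ω x‖ ^ 2 := by
        rw [Real.sqrt_mul (by norm_num), mul_assoc, Real.mul_self_sqrt hL0]
    _ ≤ Real.sqrt 27 * (27 * ∫ x, ∑ j, ‖Torus.partialDeriv j ω x‖ ^ 2) :=
        mul_le_mul_of_nonneg_left hP2 (Real.sqrt_nonneg _)
    _ = 27 * Real.sqrt 27 * ∫ x, ∑ j, ‖Torus.partialDeriv j ω x‖ ^ 2 := by ring

end Berselli2023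

variable {d : Type*} [Fintype d] [DecidableEq d]

/-- **The second line of the enstrophy display in the proof of Berselli's Thm 1.1, as a tool.**
Printed (p. 4309): "`½ d/dt‖ω‖² + ν‖∇ω‖² ≤ c₁ (C̄₁/λ) ‖u‖₂‖ω‖₂^{1/2}‖∇ω‖₂^{3/2} +
c₂ (λ/2) ‖u‖₂‖ω‖₂‖u‖_{H⁵} ≤ (C̄₁/λ)^{4/3}‖∇ω‖² + c₄‖u₀‖₂⁴‖ω‖₂² + c₃ (λ/2)‖u‖_{H⁵}‖∇ω‖₂², where
we also used the Poincaré inequality to estimate the last term from the right-hand side." Here,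
time-independently, on the unit torus `T^d` (`card d = 3` read through a frame `e`): there are
`c₃, c₄ ≥ 0` (depending on `d` only) such that for every smooth mean-zero divergence-free
`u : T^d → ℝ^d` with vorticity `ω` read in the frame (`ωₖ = W_{k⁺k⁺⁺}(u)`), every `λ > 0`,
`C̄₁ ≥ 0` and `h` with `|h| = λ` such that (4) holds at the pairs `(x, x + heⱼ)`, the stretching
term obeys `∫ ∑ⱼₖ ωⱼ (∂ⱼu)ₖ ωₖ ≤ (C̄₁/λ)^{4/3} ‖∇ω‖₂² + c₄ ‖u‖₂⁴ ‖ω‖₂² + c₃ (λ/2) ‖u‖_{H⁵} ‖∇ω‖₂²`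
with `‖∇ω‖₂² = ∫ ∑ⱼ ‖∂ⱼω‖²`, `‖u‖₂⁴ = (∫ ‖u‖²)²`, `‖ω‖₂² = ∫ ‖ω‖²`,
`‖u‖_{H⁵} = (sobolevEnergy 5 u)^{1/2}` — the coefficient `1` on `(C̄₁/λ)^{4/3}‖∇ω‖₂²` and the
exponents `4/3`, `4`, `2` as printed. Deviations (declared): `‖u‖₂` at the same time in place of
the printed `‖u₀‖₂` (the form before the energy inequality `‖u(t)‖₂ ≤ ‖u₀‖₂` is invoked);
`‖u‖_{H⁵}` as in Lemma 3.2; `|ω × ∇ω|` read as `∑ⱼ|ω × ∂ⱼω|` (inherited). A printed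
pointwise-in-time inequality, a tool; not a criterion, not a regularity statement. Proof: Lemma
3.2 (`Torus.abs_integral_vorticityStretching_le_of_sixPoint`), Young's inequality with exponents
`4/3` and `4` (`c₁(C̄₁/λ)‖u‖₂‖ω‖₂^{1/2}‖∇ω‖₂^{3/2} ≤ ¾(C̄₁/λ)^{4/3}‖∇ω‖₂² + ¼c₁⁴‖u‖₂⁴‖ω‖₂²`) and
Poincaré's inequality twice (`‖u‖₂‖ω‖₂ ≤ 27√27 ‖∇ω‖₂²`, using `∫|∇u|² = ∫|ω|²`).
[cite: Berselli2023, proof of Thm 1.1, second line of the enstrophy display (p. 4309)] -/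
theorem Torus.integral_vorticityStretching_le_of_sixPoint (e : d ≃ Fin 3) :
    ∃ c₃ c₄ : ℝ, 0 ≤ c₃ ∧ 0 ≤ c₄ ∧
      ∀ (u : UnitAddTorus d → EuclideanSpace ℝ d), IsSmooth u → HasZeroMean u → IsDivFree u →
      ∀ (ω : UnitAddTorus d → EuclideanSpace ℝ d),
        (∀ x k, ω x k = torusVorticityTensor u (e.symm (e k + 1)) (e.symm (e k + 2)) x) →
      ∀ (lam C₁ h : ℝ), 0 < lam → 0 ≤ C₁ → |h| = lam →
        (∀ (x : UnitAddTorus d) (j : d),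
          Real.sqrt (∑ k, (ω x (e.symm (e k + 1)) *
              ω (x + proj (h • EuclideanSpace.single j (1 : ℝ))) (e.symm (e k + 2)) -
            ω x (e.symm (e k + 2)) *
              ω (x + proj (h • EuclideanSpace.single j (1 : ℝ))) (e.symm (e k + 1))) ^ 2) ≤
            C₁ * ‖ω x‖ * ‖ω (x + proj (h • EuclideanSpace.single j (1 : ℝ)))‖) →
        ∫ x, ∑ j, ∑ k, ω x j * Torus.partialDeriv j u x k * ω x k ≤
          (C₁ / lam) ^ (4 / 3 : ℝ) * (∫ x, ∑ j, ‖Torus.partialDeriv j ω x‖ ^ 2) +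
            c₄ * (∫ x, ‖u x‖ ^ 2) ^ 2 * (∫ x, ‖ω x‖ ^ 2) +
            c₃ * (lam / 2) * Real.sqrt (Torus.sobolevEnergy 5 u) *
              (∫ x, ∑ j, ‖Torus.partialDeriv j ω x‖ ^ 2) := by
  obtain ⟨c₁, c₂, hc₁, hc₂, hL⟩ := Torus.abs_integral_vorticityStretching_le_of_sixPoint (d := d) e
  refine ⟨c₂ * (27 * Real.sqrt 27), c₁ ^ 4 / 4, by positivity, by positivity,
    fun u hu hmean hdivu ω hω lam C₁ h hlam hC₁ hh h4 => ?_⟩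
  have h32 := hL u hu hmean ω hω lam C₁ h hlam hC₁ hh h4
  set A := Real.sqrt (∫ x, ‖u x‖ ^ 2) with hA
  set L2 := Real.sqrt (∫ x, ‖ω x‖ ^ 2) with hL2
  set G2 := Real.sqrt (∫ x, ∑ j, ‖Torus.partialDeriv j ω x‖ ^ 2) with hG2
  set S := Real.sqrt (Torus.sobolevEnergy 5 u) with hS
  have hA0 : 0 ≤ A := Real.sqrt_nonneg _
  have hL20 : 0 ≤ L2 := Real.sqrt_nonneg _
  have hG20 : 0 ≤ G2 := Real.sqrt_nonneg _
  have hS0 : 0 ≤ S := Real.sqrt_nonneg _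
  have hP0 : 0 ≤ C₁ / lam := div_nonneg hC₁ hlam.le
  have hIu : 0 ≤ ∫ x, ‖u x‖ ^ 2 := integral_nonneg fun x => by positivity
  have hIω : 0 ≤ ∫ x, ‖ω x‖ ^ 2 := integral_nonneg fun x => by positivity
  have hIG : 0 ≤ ∫ x, ∑ j, ‖Torus.partialDeriv j ω x‖ ^ 2 :=
    integral_nonneg fun x => Finset.sum_nonneg fun j _ => by positivity
  have hAsq : (∫ x, ‖u x‖ ^ 2) = A ^ 2 := (Real.sq_sqrt hIu).symm
  have hLsq : (∫ x, ‖ω x‖ ^ 2) = L2 ^ 2 := (Real.sq_sqrt hIω).symm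
  have hGsq : (∫ x, ∑ j, ‖Torus.partialDeriv j ω x‖ ^ 2) = G2 ^ 2 := (Real.sq_sqrt hIG).symm
  -- Young `4/3`–`4` on the first term: `x = (C̄₁/λ)^{1/3} ‖∇ω‖₂^{1/2}`, `b = c₁ ‖u‖₂ ‖ω‖₂^{1/2}`
  obtain ⟨hx3, hx4⟩ := Berselli2023.rpow_third_mul_sqrt_pow hP0 hG20
  have hb4 : (c₁ * A * L2 ^ (1 / 2 : ℝ)) ^ 4 = c₁ ^ 4 * A ^ 4 * L2 ^ 2 := by
    rw [mul_pow, mul_pow, ← Real.rpow_natCast (L2 ^ (1 / 2 : ℝ)) 4, ← Real.rpow_mul hL20]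
    norm_num
  have hY := Berselli2023.pow_three_mul_le ((C₁ / lam) ^ (1 / 3 : ℝ) * G2 ^ (1 / 2 : ℝ))
    (c₁ * A * L2 ^ (1 / 2 : ℝ)) (by positivity) (by positivity)
  rw [hx3, hx4, hb4] at hY
  have hT1 : c₁ * (C₁ / lam) * A * L2 ^ (1 / 2 : ℝ) * G2 ^ (3 / 2 : ℝ) ≤
      (C₁ / lam) ^ (4 / 3 : ℝ) * G2 ^ 2 + c₁ ^ 4 / 4 * A ^ 4 * L2 ^ 2 := by
    have e1 : c₁ * (C₁ / lam) * A * L2 ^ (1 / 2 : ℝ) * G2 ^ (3 / 2 : ℝ) =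
        (C₁ / lam) * G2 ^ (3 / 2 : ℝ) * (c₁ * A * L2 ^ (1 / 2 : ℝ)) := by ring
    rw [e1]
    linarith
  -- Poincaré twice on the second term
  have hT2 : c₂ * (lam / 2) * A * L2 * S ≤ c₂ * (27 * Real.sqrt 27) * (lam / 2) * S * G2 ^ 2 := by
    have hP := Berselli2023.sqrt_mul_sqrt_le_gradNormSq e hu hmean hdivu hω
    rw [← hA, ← hL2, hGsq] at hP
    have := mul_le_mul_of_nonneg_left hP (by positivity : (0 : ℝ) ≤ c₂ * (lam / 2) * S)
    calc c₂ * (lam / 2) * A * L2 * S = c₂ * (lam / 2) * S * (A * L2) := by ring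
      _ ≤ c₂ * (lam / 2) * S * (27 * Real.sqrt 27 * G2 ^ 2) := this
      _ = _ := by ring
  rw [hAsq, hLsq, hGsq]
  calc ∫ x, ∑ j, ∑ k, ω x j * Torus.partialDeriv j u x k * ω x k
      ≤ |∫ x, ∑ j, ∑ k, ω x j * Torus.partialDeriv j u x k * ω x k| := le_abs_self _
    _ ≤ c₁ * (C₁ / lam) * A * L2 ^ (1 / 2 : ℝ) * G2 ^ (3 / 2 : ℝ) +
          c₂ * (lam / 2) * A * L2 * S := h32
    _ ≤ (C₁ / lam) ^ (4 / 3 : ℝ) * G2 ^ 2 + c₁ ^ 4 / 4 * A ^ 4 * L2 ^ 2 +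
          c₂ * (27 * Real.sqrt 27) * (lam / 2) * S * G2 ^ 2 := add_le_add hT1 hT2
    _ = (C₁ / lam) ^ (4 / 3 : ℝ) * G2 ^ 2 + c₁ ^ 4 / 4 * (A ^ 2) ^ 2 * L2 ^ 2 +
          c₂ * (27 * Real.sqrt 27) * (lam / 2) * S * G2 ^ 2 := by ring

end Literature.Analysis.FluidPDE
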